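import Literature.Combinatorics.Optimization.PsdRankBasicProperties
import Literature.Computation.Certificates.SemidefiniteComplementarity
import Literature.Analysis.Convex.FrictionConeLMI
import Literature.Combinatorics.Optimization.CorrelationPolytopePsdRank
import HarnessLib

/-!
# Exponential lower bounds on fixed-size psd rank: `(S^d_+)^r`-lifts of the correlation polytope
# (Fawzi–Parrilo 2013)

H. Fawzi, P. A. Parrilo, *Exponential lower bounds on fixed-size psd rank and semidefinite extension
complexity*, arXiv:1311.2571 [cite: FawziParrilo2013].  Everything in this file is PROVED (no facts
asserted); the one closed `Prop` is `FawziParrilo2013_thm1` with its discharge `FawziParrilo2013_thm1_holds`.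

**The result** (Thm. 1, §1.2 p. 4, verbatim): "Let `d ≥ 1` be a fixed integer. For `n ≥ d`, if `COR(n)` has
a `(S^d_+)^r`-lift for some `r ∈ ℕ`, then necessarily `r ≥ κ(d)·c(d)ⁿ` where `c(d) = (1 − 1/3^d)^{−1/d} > 1`
and `κ(d) = (3^d − 1)^{−(1−1/d)}`."  Here a `(S^d_+)^r`-lift is an SDP lift over `r` psd blocks of the FIXED
size `d` (`d = 1`: LP lifts; `d = 2`: second-order-cone lifts), i.e. (cone factorization theorem, FP13 Thm. 2
= Gouveia–Parrilo–Thomas) a decomposition of the slack matrix "as a sum of `r` nonnegative matrices each of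
psd rank `≤ d`" (§1.2 p. 5).  It is the fixed-block-size analogue of the Fiorini et al. / Kaibel–Weltge `2ⁿ`
LP bound for `COR(n)` and the literature precedent for the rung "`(S²₊)^m`-lifts of `P_PM(n)` need
`m ≥ 2^{Ω(n)}`" of cell pnp-psdrank (there the slack matrix is Edmonds'; here it is `UDISJ`).

**The printed proof, mirrored declaration by declaration** (namespace `FixedSizePsdRank`):
* §2.1–2.2 (pp. 5–7): bit strings `Cube n`, `aᵀb` (`ip`), `UDISJ(n)_{ab} = (1 − aᵀb)²` (`udisj`), the atoms
  `𝒜_{S^d_+}(n)` = matrices with an `S^d_+`-factorization vanishing where `aᵀb = 1` (`IsAtom`), and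
  `val(M)` = number of disjoint pairs `aᵀb = 0` with `M_{ab} > 0` (`val`; `val(UDISJ(n)) = 3ⁿ`, `val_udisj`;
  subadditivity `val_sum_le`).
* Def. 4 / Lemma 1 / Thm. 3 (§2.3, pp. 8–9): `k`-uniform coverings (`HasUniformCovering`), the induction lemma
  `val_N(M) ≤ Σ_t val_m(M_t)` for `{0,1}^N = {0,1}^d × {0,1}^m` (`exists_atoms_val_le_sum`), and
  `val(M) ≤ k^{⌊(n−1)/d⌋+1}` (`val_le_pow`, with the padding `ρ(m) ≤ ρ(d)` for `m ≤ d`, `exists_pad`,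
  `val_le_of_le`).
* Lemma 3 (§2.5 p. 10, proof §3 p. 12): an atom of `𝒜_{S^d_+}(d)` has a zero on the antidiagonal
  (`exists_antidiag_eq_zero`: the chain `Im V_{e_1} + ⋯ + Im V_{e_i} ⊆ Ker U_𝟙` either fills `ℝ^d` or stalls).
* Lemma 4 / Thm. 5 (§2.5, pp. 10–11): the class `C(d)` (`antidiagClass`) has a `(3^d − 1)`-uniform covering by
  the rectangles `A_{xy} = {0‖x} × {0‖y, 1‖y}`, `B_{xy} = {0‖x, 1‖x} × {0‖y}`, `C_i = 0‖R_i`, the top-left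
  antidiagonal entry being sent to the unused `A_{a'ā'}` / `B_{a'ā'}` (`hasUniformCovering_antidiagClass_succ`,
  `hasUniformCovering_antidiagClass`, `hasUniformCovering_atoms`); `|{(x,y) : xᵀy = 0}| = 3^d`
  (`card_disjointPairs`).
* Cor. 1 / eq. (9) (p. 11): `rank_{S^d_+}(UDISJ(n)) ≥ 3ⁿ/(3^d−1)^{⌊(n−1)/d⌋+1}`, stated multiplicatively
  (`three_pow_le_of_hasUniformCovering`, `three_pow_le_of_hasPsdPowerFactorization_udisj`, with
  `HasPsdPowerFactorization M d r` = factorization through `(S^d_+)^r`).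
* §2.4 (pp. 9–10), the case `d = 2`: Lemma 2 (the six sparsity patterns of an atom of `𝒜_{S²_+}(2)`,
  `exists_pattern`, via subspaces of `ℝ²`), Thm. 4 (a `7`-uniform covering by `𝔞, 𝔟, 𝔟, 𝔠, 𝔠, 𝔡, 𝔡`,
  `hasUniformCovering_atoms_two`; the maps `φ` — a figure in the paper — are the explicit table `tbl`, checked by
  `decide`), and the display `rank_{S²_+}(UDISJ(n)) ≥ (1/√7)(√(9/7))ⁿ` (`FawziParrilo2013_rank_S2_udisj`).
* §1.1 (p. 3): `(S^d_+)^1 = S^d_+`, more blocks, submatrices, and `(S^d_+)^r ⊆ S^{rd}_+`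
  (`hasPsdPowerFactorization_one_iff`, `HasPsdPowerFactorization.mono_blocks`, `.submatrix`,
  `.hasPsdFactorization`).
* Thm. 1: `UDISJ(n)` is the submatrix of the slack matrix `corrSlack n` of `COR(n)` on the rows `(1 − aᵀx)² ≥ 0`,
  i.e. `2Σ_i a_i x_i − (Σ_i a_i x_i)² ≤ 1` (§2.1 p. 5–6; `quadForm_eq`, `hasPsdPowerFactorization_udisj_of_corrSlack`),
  the case `d = 2` with `κ(2) = 1/√7`, `c(2) = √(9/7)` (`FawziParrilo2013_thm1_two`), the case `d = 1`
  (`hasPsdPowerFactorization_one_iff_nonneg`: `(S^1_+)^r` = nonnegative factorizations; `FawziParrilo2013_thm1_one`: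
  `(3/2)ⁿ ≤ r`, the LP bound), and
  `3ⁿ/(3^d−1)^{⌊(n−1)/d⌋+1} ≥ (3^d−1)^{−(1−1/d)}·((1 − 3^{−d})^{−1/d})ⁿ` (real arithmetic).
Deviations from the printed text: the induction of Thm. 3 is run on `n = d + m` with the explicit
concatenation equivalence `Fin.appendEquiv` (and `ρ(m) ≤ ρ(m + j)` by zero-padding instead of the sentence
"`ρ(1) ≤ ⋯ ≤ ρ(d) ≤ k`"); Lemma 4's induction starts at `d = 0` (`k_0 = 0`, same recursion
`k_{d+1} = k_d + 2·3^d`) instead of `d = 1`; Theorem 1 is stated for the full slack matrix of `COR(n)` in the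
factorization currency of the tree's `LeeRaghavendraSteurer2015_thm11` (the lift ⇔ factorization dictionary is
FP13 Thm. 2).  NOT here: the transfer to `CUT`, `STAB`, `TSP` (§1.2, via Fiorini et al.).
-/

noncomputable section

open Finset Matrix
open scoped MatrixOrder

namespace Literature.Combinatorics.Optimization

namespace FixedSizePsdRank

/-! ### F1. Bit strings, the unique-disjointness pattern, atoms, `val` -/

/-- Bit strings of length `n`. [cite: FawziParrilo2013, §2.1 (p. 6, "rows and columns are indexed by n-bit strings")] -/
abbrev Cube (n : ℕ) : Type := Fin n → Bool

variable {n d : ℕ}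

/-- `aᵀb` over `ℝ` for bit strings = the number of common `1`s. [cite: FawziParrilo2013, Def. 3 (§2.1, p. 6)] -/
def ip (a b : Cube n) : ℕ := (univ.filter fun i => a i = true ∧ b i = true).card

/-- The bitwise complement `ā`. [cite: FawziParrilo2013, Lemma 3 (§2.5, p. 10)] -/
def cpl (a : Cube n) : Cube n := fun i => !a i

/-- `aᵀb = bᵀa`. [cite: FawziParrilo2013, Def. 3 (§2.1, p. 6)] -/
theorem ip_comm (a b : Cube n) : ip a b = ip b a := by
  unfold ip; congr 1; ext i; simp [and_comm]

/-- `aᵀā = 0`: antidiagonal pairs are disjoint. [cite: FawziParrilo2013, Lemma 3 (§2.5, p. 10)] -/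
theorem ip_cpl_self (a : Cube n) : ip a (cpl a) = 0 := by
  unfold ip cpl
  rw [Finset.card_eq_zero, Finset.filter_eq_empty_iff]
  intro i _ h
  rw [h.1] at h
  simp at h

/-- An **atom** of `𝒜_{S^d_+}(n)`: a `2ⁿ × 2ⁿ` matrix with an `S^d_+`-factorization (psd rank `≤ d`)
vanishing on the pairs meeting in exactly one position. (Nonnegativity is automatic.)
[cite: FawziParrilo2013, §2.3 eq. (7) (p. 8)] -/
def IsAtom (d : ℕ) (M : Cube n → Cube n → ℝ) : Prop :=
  HasPsdFactorization M d ∧ ∀ a b, ip a b = 1 → M a b = 0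

/-! ### F2. The sparsity lemma: an atom of `𝒜_{S^d_+}(d)` has a zero on the antidiagonal -/

open Literature.Computation.Certificates.SemidefiniteComplementarity in
/-- **Fawzi–Parrilo, Lemma 3.** If `M ∈ 𝒜_{S^d_+}(d)` (a `2^d × 2^d` matrix of psd rank `≤ d` with
`M_{a,b} = 0` whenever `aᵀb = 1`) then `M_{a,ā} = 0` for some `a`. Printed proof: with
`M_{ab} = ⟨U_a, V_b⟩`, `Im V_{e_i} ⊆ Ker U_𝟙`; either these images span `ℝ^d` (then `U_𝟙 = 0`) or the
chain `F_i = Im V_{e_1} + ⋯ + Im V_{e_i}` stalls, `F_p = F_{p+1}`, and `a = ē_{p+1}` works.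
[cite: FawziParrilo2013, Lemma 3 (§2.5, p. 10; proof §3, p. 12)] -/
theorem exists_antidiag_eq_zero {M : Cube d → Cube d → ℝ} (hM : IsAtom d M) :
    ∃ a, M a (cpl a) = 0 := by
  classical
  obtain ⟨⟨U, V, hU, hV, hUV⟩, hzero⟩ := hM
  -- unit strings and the all-ones string
  let e : Fin d → Cube d := fun i j => decide (j = i)
  let ones : Cube d := fun _ => true
  have hcpl_e : ∀ p : Fin d, cpl (cpl (e p)) = e p := fun p => by
    funext j; simp [cpl]
  have hip_ones : ∀ i, ip ones (e i) = 1 := fun i => by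
    unfold ip
    rw [Finset.card_eq_one]
    exact ⟨i, by ext j; simp [ones, e]⟩
  have hip_cpl : ∀ p i, i ≠ p → ip (cpl (e p)) (e i) = 1 := fun p i hip => by
    unfold ip
    rw [Finset.card_eq_one]
    refine ⟨i, ?_⟩
    ext j
    simp only [cpl, e, Finset.mem_filter, Finset.mem_univ, true_and, Finset.mem_singleton,
      Bool.not_eq_true', decide_eq_false_iff_not, decide_eq_true_eq]
    constructor
    · rintro ⟨-, rfl⟩; rfl
    · rintro rfl; exact ⟨hip, rfl⟩
  -- linear maps of the factors; `M a b = 0 ↔ Im V_b ≤ Ker U_a`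
  let f : Cube d → (Fin d → ℝ) →ₗ[ℝ] (Fin d → ℝ) := fun a => Matrix.toLin' (U a)
  let g : Cube d → (Fin d → ℝ) →ₗ[ℝ] (Fin d → ℝ) := fun b => Matrix.toLin' (V b)
  have hiff : ∀ a b, M a b = 0 ↔ LinearMap.range (g b) ≤ LinearMap.ker (f a) := by
    intro a b
    rw [LinearMap.range_le_ker_iff, hUV a b]
    change _ ↔ Matrix.toLin' (U a) ∘ₗ Matrix.toLin' (V b) = 0
    rw [← Matrix.toLin'_mul, LinearEquiv.map_eq_zero_iff]
    exact trace_mul_eq_zero_iff (hU a) (hV b)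
  -- the chain `G k = Im V_{e_0} + ⋯ + Im V_{e_{k-1}}`
  let G : ℕ → Submodule ℝ (Fin d → ℝ) := fun k =>
    ⨆ i : Fin d, ⨆ (_ : (i : ℕ) < k), LinearMap.range (g (e i))
  have hGmono : ∀ k, G k ≤ G (k + 1) := fun k =>
    iSup_le fun i => iSup_le fun hi => le_iSup_of_le i (le_iSup_of_le (Nat.lt_succ_of_lt hi) le_rfl)
  have hGle : ∀ k (p : Fin d), (p : ℕ) < k → LinearMap.range (g (e p)) ≤ G k := fun k p hp =>
    le_iSup_of_le p (le_iSup_of_le hp le_rfl)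
  have hGsucc : ∀ p : Fin d, G (p + 1) ≤ G p ⊔ LinearMap.range (g (e p)) := fun p =>
    iSup_le fun i => iSup_le fun hi => by
      rcases Nat.lt_succ_iff_lt_or_eq.1 hi with h | h
      · exact le_sup_of_le_left (hGle _ i h)
      · have : i = p := Fin.ext h
        subst this
        exact le_sup_right
  -- `G d ≤ Ker U_𝟙`
  have hGd : G d ≤ LinearMap.ker (f ones) :=
    iSup_le fun i => iSup_le fun _ => (hiff ones (e i)).1 (hzero _ _ (hip_ones i))
  by_cases htop : G d = ⊤
  · -- case A: `U_𝟙 = 0`, the whole row `𝟙` vanishes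
    refine ⟨ones, (hiff ones (cpl ones)).2 ?_⟩
    rw [htop] at hGd
    exact le_trans le_top hGd
  · -- case B: the chain stalls at some `p < d`
    have hlt : Module.finrank ℝ (G d) < d := by
      have := Submodule.finrank_lt_finrank_of_lt (lt_top_iff_ne_top.2 htop)
      simpa using this
    -- pigeonhole on `k ↦ finrank (G k)`
    have hpig : ∃ p : ℕ, p < d ∧ Module.finrank ℝ (G p) = Module.finrank ℝ (G (p + 1)) := by
      by_contra hcon
      push Not at hcon
      have hgrow : ∀ k, k ≤ d → k ≤ Module.finrank ℝ (G k) := by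
        intro k
        induction k with
        | zero => intro; exact Nat.zero_le _
        | succ k ih =>
          intro hk
          have h1 := ih (Nat.le_of_succ_le hk)
          have h2 : Module.finrank ℝ (G k) ≤ Module.finrank ℝ (G (k + 1)) :=
            Submodule.finrank_mono (hGmono k)
          have h3 := hcon k (Nat.lt_of_succ_le hk)
          omega
      have := hgrow d le_rfl
      omega
    obtain ⟨p, hpd, hpeq⟩ := hpig
    have hGeq : G p = G (p + 1) := Submodule.eq_of_le_of_finrank_eq (hGmono p) hpeq
    let p' : Fin d := ⟨p, hpd⟩
    refine ⟨cpl (e p'), ?_⟩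
    rw [hcpl_e, hiff]
    -- `Im V_{e_p} ≤ G (p+1) = G p ≤ Ker U_a`
    have h1 : LinearMap.range (g (e p')) ≤ G (p + 1) := hGle _ p' (Nat.lt_succ_self p)
    have h2 : G p ≤ LinearMap.ker (f (cpl (e p'))) :=
      iSup_le fun i => iSup_le fun hi =>
        (hiff _ _).1 (hzero _ _ (hip_cpl p' i (fun h => by subst h; exact lt_irrefl _ hi)))
    exact h1.trans (hGeq ▸ h2)


/-! ### F3. `val`, uniform coverings, and the induction lemma -/

/-- `val(M)` = the number of DISJOINT pairs `(a,b)` (`aᵀb = 0`) with `M_{a,b} > 0`.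
[cite: FawziParrilo2013, §2.2 (p. 7)] -/
def val (M : Cube n → Cube n → ℝ) : ℕ :=
  (univ.filter fun p : Cube n × Cube n => ip p.1 p.2 = 0 ∧ 0 < M p.1 p.2).card

/-- `val` as a double sum of indicators. [cite: FawziParrilo2013, §2.2 (p. 7)] -/
theorem val_eq_sum (M : Cube n → Cube n → ℝ) :
    val M = ∑ a, ∑ b, if ip a b = 0 ∧ 0 < M a b then 1 else 0 := by
  classical
  rw [val, Finset.card_filter, ← Finset.univ_product_univ, Finset.sum_product]

/-- **`k`-uniform covering** of a set `S` of `2^d × 2^d` matrices (FP13 Def. 4): `k` rectangles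
`I_t × J_t` supported on disjoint pairs such that for every `M ∈ S` the positive disjoint pairs of `M`
map INJECTIVELY to rectangles containing them. [cite: FawziParrilo2013, Def. 4 (§2.3, p. 8)] -/
def HasUniformCovering (d k : ℕ) (S : Set (Cube d → Cube d → ℝ)) : Prop :=
  ∃ (I J : Fin k → Finset (Cube d)),
    (∀ t, ∀ x ∈ I t, ∀ y ∈ J t, ip x y = 0) ∧
    ∀ M ∈ S, ∃ φ : {p : Cube d × Cube d // ip p.1 p.2 = 0 ∧ 0 < M p.1 p.2} → Fin k,
      Function.Injective φ ∧ ∀ p, p.1.1 ∈ I (φ p) ∧ p.1.2 ∈ J (φ p)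

/-- Uniform coverings restrict to subsets. [cite: FawziParrilo2013, Def. 4 (§2.3, p. 8)] -/
theorem HasUniformCovering.mono {d k : ℕ} {S T : Set (Cube d → Cube d → ℝ)}
    (h : HasUniformCovering d k S) (hTS : T ⊆ S) : HasUniformCovering d k T := by
  obtain ⟨I, J, hIJ, hcov⟩ := h
  exact ⟨I, J, hIJ, fun M hM => hcov M (hTS hM)⟩

/-- A splitting `σ : {0,1}^d × {0,1}^m ≃ {0,1}^N` of bit strings compatible with `aᵀb`
(concatenation: `(x‖a)ᵀ(y‖b) = xᵀy + aᵀb`). [cite: FawziParrilo2013, Lemma 1 (§2.3, p. 8–9)] -/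
def IsIpAdditive {d m N : ℕ} (σ : Cube d × Cube m ≃ Cube N) : Prop :=
  ∀ x a y b, ip (σ (x, a)) (σ (y, b)) = ip x y + ip a b

/-- Entries of an atom are nonnegative. [cite: FawziParrilo2013, §2.3 eq. (7) (p. 8)] -/
theorem IsAtom.nonneg {D : ℕ} {M : Cube n → Cube n → ℝ} (hM : IsAtom D M) (a b : Cube n) :
    0 ≤ M a b := by
  obtain ⟨U, V, hU, hV, hUV⟩ := hM.1
  rw [hUV]
  exact Literature.Computation.Certificates.SemidefiniteComplementarity.frob_nonneg_of_posSemidef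
    (hU a) (hV b)

/-- **Fawzi–Parrilo, Lemma 1 (induction lemma).** If the atoms `𝒜_{S^D_+}(d)` have a `k`-uniform
covering `(R_t)`, then for every atom `M ∈ 𝒜_{S^D_+}(N)`, `{0,1}^N = {0,1}^d × {0,1}^m`, the matrices
`M_t = Σ_{(x,y) ∈ R_t} M^{x,y}` are atoms of `𝒜_{S^D_+}(m)` and `val_N(M) ≤ Σ_t val_m(M_t)`.
[cite: FawziParrilo2013, Lemma 1 (§2.3, pp. 8–9)] -/
theorem exists_atoms_val_le_sum {D d m N k : ℕ} (σ : Cube d × Cube m ≃ Cube N) (hσ : IsIpAdditive σ)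
    (hcov : HasUniformCovering d k {B : Cube d → Cube d → ℝ | IsAtom D B})
    {M : Cube N → Cube N → ℝ} (hM : IsAtom D M) :
    ∃ Ms : Fin k → Cube m → Cube m → ℝ, (∀ t, IsAtom D (Ms t)) ∧ val M ≤ ∑ t, val (Ms t) := by
  classical
  obtain ⟨I, J, hIJ, hcov⟩ := hcov
  have hMnn : ∀ p q, 0 ≤ M p q := hM.nonneg
  obtain ⟨⟨U, V, hU, hV, hUV⟩, hzero⟩ := hM
  -- the matrices `M_t`
  let Ms : Fin k → Cube m → Cube m → ℝ := fun t a b =>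
    ∑ x ∈ I t, ∑ y ∈ J t, M (σ (x, a)) (σ (y, b))
  have hMs_atom : ∀ t, IsAtom D (Ms t) := by
    intro t
    refine ⟨⟨fun a => ∑ x ∈ I t, U (σ (x, a)), fun b => ∑ y ∈ J t, V (σ (y, b)),
      fun a => Matrix.posSemidef_sum _ fun x _ => hU _, fun b => Matrix.posSemidef_sum _ fun y _ => hV _,
      fun a b => ?_⟩, fun a b hab => ?_⟩
    · simp only [Ms, Matrix.sum_mul, Matrix.mul_sum, Matrix.trace_sum, hUV]
      exact Finset.sum_comm
    · refine Finset.sum_eq_zero fun x hx => Finset.sum_eq_zero fun y hy => hzero _ _ ?_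
      rw [hσ, hIJ t x hx y hy, hab]
  refine ⟨Ms, hMs_atom, ?_⟩
  -- the (x,y)-block at a disjoint position (a,b) is an atom of dimension d
  have hblock : ∀ a b, ip a b = 0 → IsAtom D (fun x y => M (σ (x, a)) (σ (y, b))) := by
    intro a b hab
    refine ⟨⟨fun x => U (σ (x, a)), fun y => V (σ (y, b)), fun x => hU _, fun y => hV _,
      fun x y => hUV _ _⟩, fun x y hxy => hzero _ _ ?_⟩
    rw [hσ, hxy, hab]
  -- count: both sides as `Σ_a Σ_b (…)`
  set T : Cube d → Cube m → Cube d → Cube m → ℕ := fun x a y b =>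
    if ip (σ (x, a)) (σ (y, b)) = 0 ∧ 0 < M (σ (x, a)) (σ (y, b)) then 1 else 0 with hT
  have hL : val M = ∑ a, ∑ b, ∑ x, ∑ y, T x a y b := by
    rw [val_eq_sum, ← σ.sum_comp]
    simp_rw [← σ.sum_comp (fun q => if ip (σ _) q = 0 ∧ 0 < M (σ _) q then 1 else 0)]
    rw [Fintype.sum_prod_type_right]
    refine Finset.sum_congr rfl fun a _ => ?_
    have e1 : ∀ x : Cube d, (∑ yb : Cube d × Cube m,
        (if ip (σ (x, a)) (σ yb) = 0 ∧ 0 < M (σ (x, a)) (σ yb) then 1 else 0))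
        = ∑ b, ∑ y, T x a y b := fun x => by
      rw [Fintype.sum_prod_type_right]
    simp_rw [e1]
    exact Finset.sum_comm
  have hR : (∑ t, val (Ms t)) = ∑ a, ∑ b, ∑ t : Fin k, (if ip a b = 0 ∧ 0 < Ms t a b then 1 else 0) := by
    simp_rw [val_eq_sum]
    rw [Finset.sum_comm]
    refine Finset.sum_congr rfl fun a _ => ?_
    rw [Finset.sum_comm]
  rw [hL, hR]
  refine Finset.sum_le_sum fun a _ => Finset.sum_le_sum fun b _ => ?_
  by_cases hab : ip a b = 0
  · -- injectivity of the covering map of the block at (a,b)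
    obtain ⟨φ, hφinj, hφ⟩ := hcov _ (hblock a b hab)
    have hlhs : (∑ x : Cube d, ∑ y : Cube d, T x a y b)
        = Fintype.card {p : Cube d × Cube d // ip p.1 p.2 = 0 ∧ 0 < M (σ (p.1, a)) (σ (p.2, b))} := by
      rw [Fintype.card_subtype, Finset.card_filter, ← Finset.univ_product_univ, Finset.sum_product]
      refine Finset.sum_congr rfl fun x _ => Finset.sum_congr rfl fun y _ => ?_
      rw [hT]; simp only
      rw [hσ, hab, add_zero]
    have hrhs : (∑ t : Fin k, if ip a b = 0 ∧ 0 < Ms t a b then 1 else 0)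
        = Fintype.card {t : Fin k // 0 < Ms t a b} := by
      rw [Fintype.card_subtype, Finset.card_filter]
      refine Finset.sum_congr rfl fun t _ => by simp [hab]
    rw [hlhs, hrhs]
    let ψ : {p : Cube d × Cube d // ip p.1 p.2 = 0 ∧ 0 < M (σ (p.1, a)) (σ (p.2, b))} →
        {t : Fin k // 0 < Ms t a b} := fun p => ⟨φ p, by
          have h1 := hφ p
          calc (0 : ℝ) < M (σ (p.1.1, a)) (σ (p.1.2, b)) := p.2.2
            _ ≤ ∑ y ∈ J (φ p), M (σ (p.1.1, a)) (σ (y, b)) :=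
                Finset.single_le_sum (f := fun y => M (σ (p.1.1, a)) (σ (y, b)))
                  (fun y _ => hMnn _ _) h1.2
            _ ≤ ∑ x ∈ I (φ p), ∑ y ∈ J (φ p), M (σ (x, a)) (σ (y, b)) :=
                Finset.single_le_sum (f := fun x => ∑ y ∈ J (φ p), M (σ (x, a)) (σ (y, b)))
                  (fun x _ => Finset.sum_nonneg fun y _ => hMnn _ _) h1.1⟩
    have hψ : Function.Injective ψ := fun p q hpq => hφinj (by
      have := congrArg Subtype.val hpq; exact this)
    exact_mod_cast Fintype.card_le_of_injective ψ hψ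
  · -- non-disjoint (a,b): all pairs have intersection ≥ 1
    have : (∑ x : Cube d, ∑ y : Cube d, T x a y b) = 0 := by
      refine Finset.sum_eq_zero fun x _ => Finset.sum_eq_zero fun y _ => ?_
      rw [hT]; simp only
      rw [hσ]
      have : ip x y + ip a b ≠ 0 := by omega
      exact if_neg fun h => this h.1
    rw [this]
    exact Finset.sum_nonneg fun t _ => by split_ifs <;> simp


/-! ### F3b. Splittings of bit strings, padding, and the bound `val ≤ k^{⌊(n-1)/d⌋+1}` -/

/-- `aᵀb` as a sum of indicators. [cite: FawziParrilo2013, Def. 3 (§2.1, p. 6)] -/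
theorem ip_eq_sum (a b : Cube n) : ip a b = ∑ i, if a i = true ∧ b i = true then 1 else 0 := by
  rw [ip, Finset.card_filter]

/-- Concatenation `(x, a) ↦ x‖a` is compatible with `aᵀb`. [cite: FawziParrilo2013, Lemma 1 (§2.3, p. 9: "(x‖a)ᵀ(y‖b) = aᵀb … since xᵀy = 0")] -/
theorem isIpAdditive_appendEquiv (d m : ℕ) :
    IsIpAdditive (Fin.appendEquiv d m : Cube d × Cube m ≃ Cube (d + m)) := by
  intro x a y b
  simp only [Fin.appendEquiv_apply, ip_eq_sum]
  rw [Fin.sum_univ_add]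
  simp only [Fin.append_left, Fin.append_right]

/-- Dropping an empty suffix: `{0,1}^d × {0,1}^0 ≃ {0,1}^d` (the case `n = d` of Lemma 1, blocks of size
`1 × 1`). [cite: FawziParrilo2013, Lemma 1 and Thm. 3 (§2.3, p. 9)] -/
def dropEmptyEquiv (d : ℕ) : Cube d × Cube 0 ≃ Cube d := Equiv.prodUnique (Cube d) (Cube 0)

/-- `aᵀb = 0` on `{0,1}^0`. [folklore] -/
private theorem ip_zero (a b : Cube 0) : ip a b = 0 := by
  rw [ip, Finset.card_eq_zero, Finset.filter_eq_empty_iff]; intro i; exact i.elim0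

/-- Dropping an empty suffix is compatible with `aᵀb`. [cite: FawziParrilo2013, Lemma 1 (§2.3, p. 9)] -/
theorem isIpAdditive_dropEmptyEquiv (d : ℕ) : IsIpAdditive (dropEmptyEquiv d) := by
  intro x a y b
  simp [dropEmptyEquiv, ip_zero]

/-- A `1 × 1` matrix has `val ≤ 1`. [cite: FawziParrilo2013, Thm. 3 (§2.3, p. 9, "solving the recursion")] -/
theorem val_le_one (M : Cube 0 → Cube 0 → ℝ) : val M ≤ 1 := by
  classical
  unfold val
  calc (univ.filter fun p : Cube 0 × Cube 0 => ip p.1 p.2 = 0 ∧ 0 < M p.1 p.2).card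
      ≤ (univ : Finset (Cube 0 × Cube 0)).card := Finset.card_filter_le _ _
    _ = 1 := by simp

/-- **Padding.** An atom of `𝒜_{S^D_+}(m)` extends by zero to an atom of `𝒜_{S^D_+}(m + j)` with the
same `val` (so `ρ(m) ≤ ρ(m + j)`). [cite: FawziParrilo2013, Thm. 3 (§2.3, p. 9)] -/
theorem exists_pad {D m : ℕ} (j : ℕ) {M : Cube m → Cube m → ℝ} (hM : IsAtom D M) :
    ∃ M' : Cube (m + j) → Cube (m + j) → ℝ, IsAtom D M' ∧ val M' = val M := by
  classical
  obtain ⟨⟨U, V, hU, hV, hUV⟩, hzero⟩ := hM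
  let σ : Cube m × Cube j ≃ Cube (m + j) := Fin.appendEquiv m j
  have hσ : IsIpAdditive σ := isIpAdditive_appendEquiv m j
  let z0 : Cube j := fun _ => false
  let U' : Cube (m + j) → Matrix (Fin D) (Fin D) ℝ := fun z =>
    if (σ.symm z).2 = z0 then U (σ.symm z).1 else 0
  let V' : Cube (m + j) → Matrix (Fin D) (Fin D) ℝ := fun w =>
    if (σ.symm w).2 = z0 then V (σ.symm w).1 else 0
  let M' : Cube (m + j) → Cube (m + j) → ℝ := fun z w => (U' z * V' w).trace
  have hM'val : ∀ a x b y, M' (σ (a, x)) (σ (b, y)) =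
      if x = z0 ∧ y = z0 then M a b else 0 := by
    intro a x b y
    simp only [M', U', V', Equiv.symm_apply_apply]
    by_cases hx : x = z0 <;> by_cases hy : y = z0 <;> simp [hx, hy, hUV]
  refine ⟨M', ⟨⟨U', V', fun z => ?_, fun w => ?_, fun z w => rfl⟩, fun z w hzw => ?_⟩, ?_⟩
  · simp only [U']; split_ifs; exacts [hU _, Matrix.PosSemidef.zero]
  · simp only [V']; split_ifs; exacts [hV _, Matrix.PosSemidef.zero]
  · -- zero pattern
    obtain ⟨⟨a, x⟩, rfl⟩ := σ.surjective z
    obtain ⟨⟨b, y⟩, rfl⟩ := σ.surjective w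
    rw [hM'val]
    split_ifs with h
    · obtain ⟨rfl, rfl⟩ := h
      rw [hσ] at hzw
      have : ip z0 z0 = 0 := by
        rw [ip, Finset.card_eq_zero, Finset.filter_eq_empty_iff]; intro i _; simp [z0]
      exact hzero a b (by omega)
    · rfl
  · -- `val` is preserved
    rw [val_eq_sum, val_eq_sum, ← σ.sum_comp]
    simp_rw [← σ.sum_comp (fun q => if ip (σ _) q = 0 ∧ 0 < M' (σ _) q then 1 else 0)]
    rw [Fintype.sum_prod_type]
    refine Finset.sum_congr rfl fun a _ => ?_
    -- Σ_x Σ_b Σ_y ... : only x = z0, y = z0 contribute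
    have inner : ∀ x : Cube j, (∑ by_ : Cube m × Cube j,
        (if ip (σ (a, x)) (σ by_) = 0 ∧ 0 < M' (σ (a, x)) (σ by_) then 1 else 0))
        = if x = z0 then ∑ b, (if ip a b = 0 ∧ 0 < M a b then 1 else 0) else 0 := by
      intro x
      rw [Fintype.sum_prod_type]
      by_cases hx : x = z0
      · subst hx
        simp only [if_true]
        refine Finset.sum_congr rfl fun b _ => ?_
        rw [Finset.sum_eq_single z0]
        · rw [hM'val, hσ]
          have : ip z0 z0 = 0 := by
            rw [ip, Finset.card_eq_zero, Finset.filter_eq_empty_iff]; intro i _; simp [z0]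
          simp [this]
        · intro y _ hy
          rw [hM'val]; simp [hy]
        · intro h; exact absurd (Finset.mem_univ _) h
      · simp only [hx, if_false]
        refine Finset.sum_eq_zero fun b _ => Finset.sum_eq_zero fun y _ => ?_
        rw [hM'val]; simp [hx]
    simp_rw [inner]
    rw [Finset.sum_ite_eq' univ z0]
    simp

/-- Atoms of small dimension: `val(M) ≤ k` for `M ∈ 𝒜_{S^D_+}(m)`, `m ≤ d`, given a `k`-uniform
covering of `𝒜_{S^D_+}(d)` ("`ρ_K(d) ≤ k`"). [cite: FawziParrilo2013, Thm. 3 (§2.3, p. 9)] -/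
theorem val_le_of_le {D d k m : ℕ} (hcov : HasUniformCovering d k {B : Cube d → Cube d → ℝ | IsAtom D B})
    (hm : m ≤ d) {M : Cube m → Cube m → ℝ} (hM : IsAtom D M) : val M ≤ k := by
  obtain ⟨j, rfl⟩ := Nat.exists_eq_add_of_le hm
  obtain ⟨M', hM', hval⟩ := exists_pad j hM
  obtain ⟨Ms, hMs, hle⟩ := exists_atoms_val_le_sum (dropEmptyEquiv (m + j))
    (isIpAdditive_dropEmptyEquiv (m + j)) hcov hM'
  rw [← hval]
  calc val M' ≤ ∑ t, val (Ms t) := hle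
    _ ≤ ∑ _t : Fin k, 1 := Finset.sum_le_sum fun t _ => val_le_one _
    _ = k := by simp

/-- **Fawzi–Parrilo, Theorem 3.** If `𝒜_{S^D_+}(d)` (`d ≥ 1`) has a `k`-uniform covering then every
atom `M ∈ 𝒜_{S^D_+}(n)`, `n ≥ d`, has `val(M) ≤ k^{⌊(n-1)/d⌋ + 1}`.
[cite: FawziParrilo2013, Thm. 3 (§2.3, pp. 8–9)] -/
theorem val_le_pow {D d k : ℕ} (hd : 1 ≤ d)
    (hcov : HasUniformCovering d k {B : Cube d → Cube d → ℝ | IsAtom D B}) :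
    ∀ n, d ≤ n → ∀ M : Cube n → Cube n → ℝ, IsAtom D M → val M ≤ k ^ ((n - 1) / d + 1) := by
  intro n
  induction n using Nat.strong_induction_on with
  | _ n ih =>
    intro hn M hM
    obtain ⟨m, rfl⟩ := Nat.exists_eq_add_of_le hn
    obtain ⟨Ms, hMs, hle⟩ := exists_atoms_val_le_sum (Fin.appendEquiv d m)
      (isIpAdditive_appendEquiv d m) hcov hM
    refine hle.trans ?_
    rcases Nat.eq_zero_or_pos m with rfl | hm0
    · -- `m = 0`: the `M_t` are `1 × 1`
      have hexp : (d + 0 - 1) / d + 1 = 1 := by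
        rw [Nat.add_zero, Nat.div_eq_of_lt (by omega)]
      rw [hexp, pow_one]
      calc ∑ t, val (Ms t) ≤ ∑ _t : Fin k, 1 := Finset.sum_le_sum fun t _ => val_le_one _
        _ = k := by simp
    by_cases hmd : m ≤ d
    · -- `1 ≤ m ≤ d`: each `val(M_t) ≤ k`
      have h1 : (d + m - 1) / d = 1 := Nat.div_eq_of_lt_le (by omega) (by omega)
      rw [h1]
      calc ∑ t, val (Ms t) ≤ ∑ _t : Fin k, k :=
            Finset.sum_le_sum fun t _ => val_le_of_le hcov hmd (hMs t)
        _ = k ^ (1 + 1) := by simp [sq]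
    · -- `m > d`: induction hypothesis at `m`
      have IH := ih m (by omega) (by omega)
      have hexp : (d + m - 1) / d + 1 = (m - 1) / d + 1 + 1 := by
        have : d + m - 1 = (m - 1) + d := by omega
        rw [this, Nat.add_div_right _ (by omega)]
      rw [hexp, pow_succ]
      calc ∑ t, val (Ms t) ≤ ∑ _t : Fin k, k ^ ((m - 1) / d + 1) :=
            Finset.sum_le_sum fun t _ => IH _ (hMs t)
        _ = k ^ ((m - 1) / d + 1) * k := by simp [mul_comm]


/-! ### F4. A `(3^d - 1)`-uniform covering of `C(d)` ⊇ `𝒜_{S^d_+}(d)` (FP13 Lemma 4 / Theorem 5) -/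

/-- `aᵀb = 0` iff `a, b` have no common `1`. [cite: FawziParrilo2013, §2.2 (p. 7, "disjoint pairs")] -/
theorem ip_eq_zero_iff (a b : Cube n) : ip a b = 0 ↔ ∀ i, ¬(a i = true ∧ b i = true) := by
  rw [ip, Finset.card_eq_zero, Finset.filter_eq_empty_iff]
  simp

/-- The number of disjoint pairs `(a,b) ∈ {0,1}^d × {0,1}^d` (`aᵀb = 0`) is `3^d`.
[cite: FawziParrilo2013, §2.2 (p. 7, "val(UDISJ(n)) = 3ⁿ")] -/
theorem card_disjointPairs (d : ℕ) :
    Fintype.card {p : Cube d × Cube d // ip p.1 p.2 = 0} = 3 ^ d := by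
  classical
  let e : {p : Cube d × Cube d // ip p.1 p.2 = 0} ≃
      (Fin d → {q : Bool × Bool // ¬(q.1 = true ∧ q.2 = true)}) :=
    { toFun := fun p i => ⟨(p.1.1 i, p.1.2 i), (ip_eq_zero_iff _ _).1 p.2 i⟩
      invFun := fun f => ⟨(fun i => (f i).1.1, fun i => (f i).1.2),
        (ip_eq_zero_iff _ _).2 fun i => (f i).2⟩
      left_inv := fun p => rfl
      right_inv := fun f => rfl }
  have h3 : Fintype.card {q : Bool × Bool // ¬(q.1 = true ∧ q.2 = true)} = 3 := by decide
  rw [Fintype.card_congr e, Fintype.card_fun, Fintype.card_fin, h3]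

/-- Prepending a bit, `b‖x ∈ {0,1}^{d+1}`. [cite: FawziParrilo2013, Lemma 4 (§2.5, p. 10, "0‖x, 1‖x")] -/
def pre (b : Bool) (x : Cube d) : Cube (d + 1) := Fin.cons b x

/-- The head of `b‖x` is `b`. [cite: FawziParrilo2013, Lemma 4 (§2.5, p. 10)] -/
@[simp] theorem pre_zero (b : Bool) (x : Cube d) : pre b x 0 = b := rfl

/-- The tail entries of `b‖x` are those of `x`. [cite: FawziParrilo2013, Lemma 4 (§2.5, p. 10)] -/
@[simp] theorem pre_succ (b : Bool) (x : Cube d) (i : Fin d) : pre b x i.succ = x i := rfl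

/-- The tail of `b‖x` is `x`. [cite: FawziParrilo2013, Lemma 4 (§2.5, p. 10)] -/
@[simp] theorem tail_pre (b : Bool) (x : Cube d) : Fin.tail (pre b x) = x := Fin.tail_cons _ _

/-- Every `z ∈ {0,1}^{d+1}` is `z₀‖tail z`. [cite: FawziParrilo2013, Lemma 4 (§2.5, p. 10)] -/
theorem pre_self_tail (z : Cube (d + 1)) : pre (z 0) (Fin.tail z) = z := Fin.cons_self_tail z

/-- `b‖x = c‖y ↔ b = c ∧ x = y`. [cite: FawziParrilo2013, Lemma 4 (§2.5, p. 10)] -/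
theorem pre_inj {b c : Bool} {x y : Cube d} : pre b x = pre c y ↔ b = c ∧ x = y := Fin.cons_inj

/-- `(b‖x)ᵀ(c‖y) = bc + xᵀy`. [cite: FawziParrilo2013, Lemma 4 (§2.5, p. 10–11)] -/
theorem ip_pre (b c : Bool) (x y : Cube d) :
    ip (pre b x) (pre c y) = (if b = true ∧ c = true then 1 else 0) + ip x y := by
  rw [ip_eq_sum, ip_eq_sum x y, Fin.sum_univ_succ]
  congr 1

/-- The complement of `b‖x` is `b̄‖x̄`. [cite: FawziParrilo2013, Lemma 4 (§2.5, p. 11)] -/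
theorem cpl_pre (b : Bool) (x : Cube d) : cpl (pre b x) = pre (!b) (cpl x) := by
  funext i
  refine Fin.cases ?_ (fun j => ?_) i
  · simp [cpl]
  · simp [cpl]

/-- Heads of a disjoint pair are not both `1`, tails are disjoint. [cite: FawziParrilo2013, Lemma 4 (§2.5, p. 11)] -/
theorem head_tail_of_ip_eq_zero {z w : Cube (d + 1)} (h : ip z w = 0) :
    ¬(z 0 = true ∧ w 0 = true) ∧ ip (Fin.tail z) (Fin.tail w) = 0 := by
  rw [← pre_self_tail z, ← pre_self_tail w, ip_pre] at h
  constructor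
  · intro hh; rw [if_pos hh] at h; omega
  · omega

/-- Fawzi–Parrilo's class `C(d)`: entrywise nonnegative `2^d × 2^d` matrices vanishing on the pairs with
`aᵀb = 1` and having a zero on the antidiagonal. [cite: FawziParrilo2013, §2.5 (p. 10, display defining C(d))] -/
def antidiagClass (d : ℕ) : Set (Cube d → Cube d → ℝ) :=
  {M | (∀ a b, 0 ≤ M a b) ∧ (∀ a b, ip a b = 1 → M a b = 0) ∧ ∃ a, M a (cpl a) = 0}

/-- `𝒜_{S^d_+}(d) ⊆ C(d)` (by Lemma 3). [cite: FawziParrilo2013, §2.5 (p. 10)] -/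
theorem isAtom_subset_antidiagClass (d : ℕ) :
    {B : Cube d → Cube d → ℝ | IsAtom d B} ⊆ antidiagClass d := fun _ hB =>
  ⟨hB.nonneg, hB.2, exists_antidiag_eq_zero hB⟩

/-- Re-indexing a uniform covering by a finite type of cardinality `k`. [cite: FawziParrilo2013, Def. 4 (§2.3, p. 8)] -/
theorem HasUniformCovering.of_fintype {ι : Type*} [Fintype ι] {d k : ℕ}
    {S : Set (Cube d → Cube d → ℝ)} (hk : Fintype.card ι = k) (I J : ι → Finset (Cube d))
    (hIJ : ∀ t, ∀ x ∈ I t, ∀ y ∈ J t, ip x y = 0)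
    (hcov : ∀ M ∈ S, ∃ φ : {p : Cube d × Cube d // ip p.1 p.2 = 0 ∧ 0 < M p.1 p.2} → ι,
      Function.Injective φ ∧ ∀ p, p.1.1 ∈ I (φ p) ∧ p.1.2 ∈ J (φ p)) :
    HasUniformCovering d k S := by
  let e : ι ≃ Fin k := Fintype.equivFinOfCardEq hk
  refine ⟨fun t => I (e.symm t), fun t => J (e.symm t), fun t => hIJ _, fun M hM => ?_⟩
  obtain ⟨φ, hφ, hmem⟩ := hcov M hM
  refine ⟨e ∘ φ, e.injective.comp hφ, fun p => ?_⟩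
  simp only [Function.comp, Equiv.symm_apply_apply]
  exact hmem p

/-- The empty covering of `C(0)` (its only entry is the antidiagonal one, which vanishes).
[cite: FawziParrilo2013, §2.5 (p. 10, "C(1) … k = 3¹ − 1 = 2", base of the induction)] -/
theorem hasUniformCovering_antidiagClass_zero : HasUniformCovering 0 0 (antidiagClass 0) := by
  refine ⟨Fin.elim0, Fin.elim0, fun t => t.elim0, fun M hM => ?_⟩
  obtain ⟨-, -, a, ha⟩ := hM
  have hempty : ∀ p : {p : Cube 0 × Cube 0 // ip p.1 p.2 = 0 ∧ 0 < M p.1 p.2}, False := by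
    intro p
    have h1 : p.1.1 = a := funext fun i => i.elim0
    have h2 : p.1.2 = cpl a := funext fun i => i.elim0
    have := p.2.2
    rw [h1, h2, ha] at this
    exact lt_irrefl _ this
  exact ⟨fun p => (hempty p).elim, fun p => (hempty p).elim, fun p => (hempty p).elim⟩

/-- **Fawzi–Parrilo, Lemma 4.** A `k`-uniform covering of `C(d)` yields a `(k + 2·3^d)`-uniform covering
of `C(d+1)`: rectangles `A_{xy} = {0‖x} × {0‖y, 1‖y}`, `B_{xy} = {0‖x, 1‖x} × {0‖y}` (`xᵀy = 0`) and
`C_i = {(0‖x, 0‖y) : (x,y) ∈ R_i}`; top-right entries go to `A`, bottom-left to `B`, the top-left block —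
with its antidiagonal entry `(0‖a', 0‖ā')` sent to the unused `A_{a'ā'}` (resp. `B_{a'ā'}`) — to the `C_i`
by the hypothesis. [cite: FawziParrilo2013, Lemma 4 (§2.5, pp. 10–11)] -/
theorem hasUniformCovering_antidiagClass_succ {d k : ℕ}
    (h : HasUniformCovering d k (antidiagClass d)) :
    HasUniformCovering (d + 1) (k + 2 * 3 ^ d) (antidiagClass (d + 1)) := by
  classical
  obtain ⟨I, J, hIJ, hcov⟩ := h
  -- index type `Fin k ⊕ (DP ⊕ DP)`, `DP` = disjoint pairs of `{0,1}^d`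
  have hcard : Fintype.card (Fin k ⊕ ({p : Cube d × Cube d // ip p.1 p.2 = 0} ⊕
      {p : Cube d × Cube d // ip p.1 p.2 = 0})) = k + 2 * 3 ^ d := by
    simp only [Fintype.card_sum, Fintype.card_fin, card_disjointPairs]; ring
  let l0 : Cube d ↪ Cube (d + 1) := ⟨pre false, fun x y hxy => (pre_inj.1 hxy).2⟩
  let I' : Fin k ⊕ ({p : Cube d × Cube d // ip p.1 p.2 = 0} ⊕ {p : Cube d × Cube d // ip p.1 p.2 = 0}) →
      Finset (Cube (d + 1)) := fun s =>
    match s with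
    | Sum.inl t => (I t).map l0
    | Sum.inr (Sum.inl p) => {pre false p.1.1}
    | Sum.inr (Sum.inr p) => {pre false p.1.1, pre true p.1.1}
  let J' : Fin k ⊕ ({p : Cube d × Cube d // ip p.1 p.2 = 0} ⊕ {p : Cube d × Cube d // ip p.1 p.2 = 0}) →
      Finset (Cube (d + 1)) := fun s =>
    match s with
    | Sum.inl t => (J t).map l0
    | Sum.inr (Sum.inl p) => {pre false p.1.2, pre true p.1.2}
    | Sum.inr (Sum.inr p) => {pre false p.1.2}
  refine HasUniformCovering.of_fintype hcard I' J' ?_ ?_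
  · -- all rectangles are supported on disjoint pairs
    rintro (t | p | p) x hx y hy
    · obtain ⟨x', hx', rfl⟩ := Finset.mem_map.1 hx
      obtain ⟨y', hy', rfl⟩ := Finset.mem_map.1 hy
      change ip (pre false x') (pre false y') = 0
      rw [ip_pre, hIJ t x' hx' y' hy']; simp
    · have hx' : x = pre false p.1.1 := by simpa [I'] using hx
      have hy' : y = pre false p.1.2 ∨ y = pre true p.1.2 := by simpa [J'] using hy
      rcases hy' with rfl | rfl <;> rw [hx', ip_pre, p.2] <;> simp
    · have hx' : x = pre false p.1.1 ∨ x = pre true p.1.1 := by simpa [I'] using hx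
      have hy' : y = pre false p.1.2 := by simpa [J'] using hy
      rcases hx' with rfl | rfl <;> rw [hy', ip_pre, p.2] <;> simp
  · -- the covering map for `M ∈ C(d+1)`
    intro M hM
    obtain ⟨hnn, hz1, a, ha⟩ := hM
    -- `a = a₀‖a'`, `ā = ā₀‖ā'`
    have ha_eq : a = pre (a 0) (Fin.tail a) := (pre_self_tail a).symm
    have hca_eq : cpl a = pre (!(a 0)) (cpl (Fin.tail a)) := by
      conv_lhs => rw [ha_eq, cpl_pre]
    have hsp : ip (Fin.tail a) (cpl (Fin.tail a)) = 0 := ip_cpl_self _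
    -- the top-left block with its antidiagonal entry `(a', ā')` zeroed is in `C(d)`
    let M0 : Cube d → Cube d → ℝ := fun x y =>
      if x = Fin.tail a ∧ y = cpl (Fin.tail a) then 0 else M (pre false x) (pre false y)
    have hM0 : M0 ∈ antidiagClass d := by
      refine ⟨fun x y => ?_, fun x y hxy => ?_, Fin.tail a, by simp [M0]⟩
      · simp only [M0]; split_ifs; exacts [le_rfl, hnn _ _]
      · simp only [M0]; split_ifs; · rfl
        apply hz1; rw [ip_pre, hxy]; simp
    obtain ⟨φ0, hφ0, hmem0⟩ := hcov M0 hM0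
    -- the special rectangle receiving the top-left antidiagonal entry `(0‖a', 0‖ā')`
    let sp : Fin k ⊕ ({p : Cube d × Cube d // ip p.1 p.2 = 0} ⊕ {p : Cube d × Cube d // ip p.1 p.2 = 0}) :=
      if a 0 = true then Sum.inr (Sum.inr ⟨(Fin.tail a, cpl (Fin.tail a)), hsp⟩)
      else Sum.inr (Sum.inl ⟨(Fin.tail a, cpl (Fin.tail a)), hsp⟩)
    -- top-left positive entries other than the special one are positive entries of `M0`
    have hM0pos : ∀ p : {p : Cube (d + 1) × Cube (d + 1) // ip p.1 p.2 = 0 ∧ 0 < M p.1 p.2},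
        ¬ p.1.2 0 = true → ¬ p.1.1 0 = true →
        ¬ (Fin.tail p.1.1 = Fin.tail a ∧ Fin.tail p.1.2 = cpl (Fin.tail a)) →
        0 < M0 (Fin.tail p.1.1) (Fin.tail p.1.2) := by
      intro p hw hz hs
      simp only [M0, if_neg hs]
      have h1 : pre false (Fin.tail p.1.1) = p.1.1 := by
        conv_rhs => rw [← pre_self_tail p.1.1]
        rw [Bool.eq_false_iff.2 hz]
      have h2 : pre false (Fin.tail p.1.2) = p.1.2 := by
        conv_rhs => rw [← pre_self_tail p.1.2]
        rw [Bool.eq_false_iff.2 hw]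
      rw [h1, h2]; exact p.2.2
    let φ : {p : Cube (d + 1) × Cube (d + 1) // ip p.1 p.2 = 0 ∧ 0 < M p.1 p.2} →
        Fin k ⊕ ({p : Cube d × Cube d // ip p.1 p.2 = 0} ⊕ {p : Cube d × Cube d // ip p.1 p.2 = 0}) :=
      fun p =>
        if hw : p.1.2 0 = true then
          Sum.inr (Sum.inl ⟨(Fin.tail p.1.1, Fin.tail p.1.2), (head_tail_of_ip_eq_zero p.2.1).2⟩)
        else if hz : p.1.1 0 = true then
          Sum.inr (Sum.inr ⟨(Fin.tail p.1.1, Fin.tail p.1.2), (head_tail_of_ip_eq_zero p.2.1).2⟩)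
        else if hs : Fin.tail p.1.1 = Fin.tail a ∧ Fin.tail p.1.2 = cpl (Fin.tail a) then sp
        else Sum.inl (φ0 ⟨(Fin.tail p.1.1, Fin.tail p.1.2), (head_tail_of_ip_eq_zero p.2.1).2,
          hM0pos p hw hz hs⟩)
    -- the pair `(a, ā)` itself is not a positive entry
    have hnot : ∀ p : {p : Cube (d + 1) × Cube (d + 1) // ip p.1 p.2 = 0 ∧ 0 < M p.1 p.2},
        ¬ (p.1.1 = a ∧ p.1.2 = cpl a) := by
      rintro p ⟨h1, h2⟩
      have := p.2.2
      rw [h1, h2, ha] at this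
      exact lt_irrefl _ this
    -- description of the fibres of `φ`
    have hA : ∀ p P, φ p = Sum.inr (Sum.inl P) →
        p.1.1 0 = false ∧ (Fin.tail p.1.1, Fin.tail p.1.2) = P.1 ∧
          (p.1.2 0 = true ∨ (p.1.2 0 = false ∧ P.1 = (Fin.tail a, cpl (Fin.tail a)) ∧ a 0 = false)) := by
      intro p P hP
      have hzw := (head_tail_of_ip_eq_zero p.2.1).1
      simp only [φ] at hP
      by_cases hw : p.1.2 0 = true
      · rw [dif_pos hw] at hP
        have hP' := Subtype.ext_iff.1 (Sum.inl.inj (Sum.inr.inj hP))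
        refine ⟨?_, hP', Or.inl hw⟩
        cases hz : p.1.1 0
        · rfl
        · exact absurd ⟨hz, hw⟩ hzw
      rw [dif_neg hw] at hP
      by_cases hz : p.1.1 0 = true
      · rw [dif_pos hz] at hP; cases Sum.inr.inj hP
      rw [dif_neg hz] at hP
      by_cases hs : Fin.tail p.1.1 = Fin.tail a ∧ Fin.tail p.1.2 = cpl (Fin.tail a)
      · rw [dif_pos hs] at hP
        simp only [sp] at hP
        by_cases ha0 : a 0 = true
        · rw [if_pos ha0] at hP; cases Sum.inr.inj hP
        rw [if_neg ha0] at hP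
        have hP' := Subtype.ext_iff.1 (Sum.inl.inj (Sum.inr.inj hP))
        simp only at hP'
        refine ⟨Bool.eq_false_iff.2 hz, ?_, Or.inr ⟨Bool.eq_false_iff.2 hw, ?_, Bool.eq_false_iff.2 ha0⟩⟩
        · rw [← hP', hs.1, hs.2]
        · rw [← hP']
      · rw [dif_neg hs] at hP; cases hP
    have hB : ∀ p P, φ p = Sum.inr (Sum.inr P) →
        p.1.2 0 = false ∧ (Fin.tail p.1.1, Fin.tail p.1.2) = P.1 ∧
          (p.1.1 0 = true ∨ (p.1.1 0 = false ∧ P.1 = (Fin.tail a, cpl (Fin.tail a)) ∧ a 0 = true)) := by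
      intro p P hP
      have hzw := (head_tail_of_ip_eq_zero p.2.1).1
      simp only [φ] at hP
      by_cases hw : p.1.2 0 = true
      · rw [dif_pos hw] at hP; cases Sum.inr.inj hP
      rw [dif_neg hw] at hP
      by_cases hz : p.1.1 0 = true
      · rw [dif_pos hz] at hP
        have hP' := Subtype.ext_iff.1 (Sum.inr.inj (Sum.inr.inj hP))
        exact ⟨Bool.eq_false_iff.2 hw, hP', Or.inl hz⟩
      rw [dif_neg hz] at hP
      by_cases hs : Fin.tail p.1.1 = Fin.tail a ∧ Fin.tail p.1.2 = cpl (Fin.tail a)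
      · rw [dif_pos hs] at hP
        simp only [sp] at hP
        by_cases ha0 : a 0 = true
        · rw [if_pos ha0] at hP
          have hP' := Subtype.ext_iff.1 (Sum.inr.inj (Sum.inr.inj hP))
          simp only at hP'
          refine ⟨Bool.eq_false_iff.2 hw, ?_, Or.inr ⟨Bool.eq_false_iff.2 hz, ?_, ha0⟩⟩
          · rw [← hP', hs.1, hs.2]
          · rw [← hP']
        · rw [if_neg ha0] at hP; cases Sum.inr.inj hP
      · rw [dif_neg hs] at hP; cases hP
    have hC : ∀ p t, φ p = Sum.inl t →
        p.1.1 0 = false ∧ p.1.2 0 = false ∧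
          ∃ h, t = φ0 ⟨(Fin.tail p.1.1, Fin.tail p.1.2), h⟩ := by
      intro p t hP
      simp only [φ] at hP
      by_cases hw : p.1.2 0 = true
      · rw [dif_pos hw] at hP; cases hP
      rw [dif_neg hw] at hP
      by_cases hz : p.1.1 0 = true
      · rw [dif_pos hz] at hP; cases hP
      rw [dif_neg hz] at hP
      by_cases hs : Fin.tail p.1.1 = Fin.tail a ∧ Fin.tail p.1.2 = cpl (Fin.tail a)
      · rw [dif_pos hs] at hP
        simp only [sp] at hP
        split_ifs at hP
      · rw [dif_neg hs] at hP
        exact ⟨Bool.eq_false_iff.2 hz, Bool.eq_false_iff.2 hw, _, (Sum.inl.inj hP).symm⟩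
    -- reconstructing a pair from heads and tails
    have hrec : ∀ p q : {p : Cube (d + 1) × Cube (d + 1) // ip p.1 p.2 = 0 ∧ 0 < M p.1 p.2},
        p.1.1 0 = q.1.1 0 → p.1.2 0 = q.1.2 0 →
        (Fin.tail p.1.1, Fin.tail p.1.2) = (Fin.tail q.1.1, Fin.tail q.1.2) → p = q := by
      intro p q h1 h2 h3
      obtain ⟨h3a, h3b⟩ := Prod.mk.inj h3
      apply Subtype.ext
      refine Prod.ext ?_ ?_
      · rw [← pre_self_tail p.1.1, ← pre_self_tail q.1.1, h1, h3a]
      · rw [← pre_self_tail p.1.2, ← pre_self_tail q.1.2, h2, h3b]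
    refine ⟨φ, fun p q hpq => ?_, fun p => ?_⟩
    · -- injectivity
      rcases hq : φ q with t | P | P
      · obtain ⟨hp1, hp2, hp, hp3⟩ := hC p t (hpq.trans hq)
        obtain ⟨hq1, hq2, hq', hq3⟩ := hC q t hq
        have := hφ0 (hp3.symm.trans hq3)
        have htl := congrArg Subtype.val this
        exact hrec p q (hp1.trans hq1.symm) (hp2.trans hq2.symm) htl
      · obtain ⟨hp1, hp2, hp3⟩ := hA p P (hpq.trans hq)
        obtain ⟨hq1, hq2, hq3⟩ := hA q P hq
        have htl := hp2.trans hq2.symm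
        rcases hp3 with hp3 | ⟨hp3, hPa, ha0⟩ <;> rcases hq3 with hq3 | ⟨hq3, hQa, ha0'⟩
        · exact hrec p q (hp1.trans hq1.symm) (hp3.trans hq3.symm) htl
        · -- `p` top-right with tails `(a', ā')`: then `p = (a, ā)`, impossible
          exfalso; refine hnot p ⟨?_, ?_⟩
          · rw [← pre_self_tail p.1.1, hp1, ha_eq, ha0', (Prod.mk.inj (hp2.trans hQa)).1]
          · rw [← pre_self_tail p.1.2, hp3, hca_eq, ha0', (Prod.mk.inj (hp2.trans hQa)).2]; rfl
        · exfalso; refine hnot q ⟨?_, ?_⟩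
          · rw [← pre_self_tail q.1.1, hq1, ha_eq, ha0, (Prod.mk.inj (hq2.trans hPa)).1]
          · rw [← pre_self_tail q.1.2, hq3, hca_eq, ha0, (Prod.mk.inj (hq2.trans hPa)).2]; rfl
        · exact hrec p q (hp1.trans hq1.symm) (hp3.trans hq3.symm) htl
      · obtain ⟨hp1, hp2, hp3⟩ := hB p P (hpq.trans hq)
        obtain ⟨hq1, hq2, hq3⟩ := hB q P hq
        have htl := hp2.trans hq2.symm
        rcases hp3 with hp3 | ⟨hp3, hPa, ha0⟩ <;> rcases hq3 with hq3 | ⟨hq3, hQa, ha0'⟩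
        · exact hrec p q (hp3.trans hq3.symm) (hp1.trans hq1.symm) htl
        · exfalso; refine hnot p ⟨?_, ?_⟩
          · rw [← pre_self_tail p.1.1, hp3, ha_eq, ha0', (Prod.mk.inj (hp2.trans hQa)).1]
          · rw [← pre_self_tail p.1.2, hp1, hca_eq, ha0', (Prod.mk.inj (hp2.trans hQa)).2]; rfl
        · exfalso; refine hnot q ⟨?_, ?_⟩
          · rw [← pre_self_tail q.1.1, hq3, ha_eq, ha0, (Prod.mk.inj (hq2.trans hPa)).1]
          · rw [← pre_self_tail q.1.2, hq1, hca_eq, ha0, (Prod.mk.inj (hq2.trans hPa)).2]; rfl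
        · exact hrec p q (hp3.trans hq3.symm) (hp1.trans hq1.symm) htl
    · -- membership in the rectangles
      have hzw := (head_tail_of_ip_eq_zero p.2.1).1
      rcases hq : φ p with t | P | P
      · obtain ⟨hp1, hp2, hp, hp3⟩ := hC p t hq
        have hm := hmem0 ⟨(Fin.tail p.1.1, Fin.tail p.1.2), hp⟩
        rw [← hp3] at hm
        constructor
        · change p.1.1 ∈ (I t).map l0
          rw [Finset.mem_map]
          exact ⟨_, hm.1, by change pre false _ = _; rw [← hp1]; exact pre_self_tail _⟩
        · change p.1.2 ∈ (J t).map l0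
          rw [Finset.mem_map]
          exact ⟨_, hm.2, by change pre false _ = _; rw [← hp2]; exact pre_self_tail _⟩
      · obtain ⟨hp1, hp2, hp3⟩ := hA p P hq
        obtain ⟨hP1, hP2⟩ := Prod.mk.inj hp2
        constructor
        · change p.1.1 ∈ ({pre false P.1.1} : Finset _)
          rw [Finset.mem_singleton, ← hP1, ← hp1, pre_self_tail]
        · change p.1.2 ∈ ({pre false P.1.2, pre true P.1.2} : Finset _)
          rw [Finset.mem_insert, Finset.mem_singleton, ← hP2]
          rcases hp3 with h | ⟨h, -, -⟩
          · right; rw [← h, pre_self_tail]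
          · left; rw [← h, pre_self_tail]
      · obtain ⟨hp1, hp2, hp3⟩ := hB p P hq
        obtain ⟨hP1, hP2⟩ := Prod.mk.inj hp2
        constructor
        · change p.1.1 ∈ ({pre false P.1.1, pre true P.1.1} : Finset _)
          rw [Finset.mem_insert, Finset.mem_singleton, ← hP1]
          rcases hp3 with h | ⟨h, -, -⟩
          · right; rw [← h, pre_self_tail]
          · left; rw [← h, pre_self_tail]
        · change p.1.2 ∈ ({pre false P.1.2} : Finset _)
          rw [Finset.mem_singleton, ← hP2, ← hp1, pre_self_tail]

/-- **Fawzi–Parrilo, Theorem 5 (via Lemma 4).** `C(d)` has a `(3^d − 1)`-uniform covering.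
[cite: FawziParrilo2013, Thm. 5 and Lemma 4 (§2.5, p. 10: "k_d = k_{d−1} + 2·3^{d−1}, k_1 = 2 ⇒ k_d = 3^d − 1")] -/
theorem hasUniformCovering_antidiagClass (d : ℕ) :
    HasUniformCovering d (3 ^ d - 1) (antidiagClass d) := by
  induction d with
  | zero => exact hasUniformCovering_antidiagClass_zero
  | succ d ih =>
    have h := hasUniformCovering_antidiagClass_succ ih
    have heq : 3 ^ d - 1 + 2 * 3 ^ d = 3 ^ (d + 1) - 1 := by
      have : 1 ≤ 3 ^ d := Nat.one_le_pow _ _ (by norm_num)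
      rw [pow_succ]; omega
    rwa [heq] at h

/-- **Fawzi–Parrilo, Theorem 5.** `𝒜_{S^d_+}(d)` has a `k`-uniform covering with `k = 3^d − 1 < 3^d`.
[cite: FawziParrilo2013, Thm. 5 (§2.5, p. 10)] -/
theorem hasUniformCovering_atoms (d : ℕ) :
    HasUniformCovering d (3 ^ d - 1) {B : Cube d → Cube d → ℝ | IsAtom d B} :=
  (hasUniformCovering_antidiagClass d).mono (isAtom_subset_antidiagClass d)


/-! ### F5. `UDISJ(n)`: `val = 3ⁿ`, subadditivity of `val`, and eq. (9) -/

/-- The unique-disjointness matrix `UDISJ(n)_{a,b} = (1 − aᵀb)²` (`a, b ∈ {0,1}ⁿ`).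
[cite: FawziParrilo2013, Def. 3 (§2.1, p. 6)] -/
def udisj (n : ℕ) (a b : Cube n) : ℝ := (1 - (ip a b : ℝ)) ^ 2

/-- `val(UDISJ(n)) = 3ⁿ` (the disjoint pairs carry the entry `1`). [cite: FawziParrilo2013, §2.2 (p. 7)] -/
theorem val_udisj (n : ℕ) : val (udisj n) = 3 ^ n := by
  classical
  rw [← card_disjointPairs n, Fintype.card_subtype, val]
  congr 1
  refine Finset.filter_congr fun p _ => ⟨fun h => h.1, fun h => ⟨h, ?_⟩⟩
  simp [udisj, h]

/-- `val` is subadditive over sums of matrices (a positive sum has a positive term).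
[cite: FawziParrilo2013, §2.2–2.3 (p. 8, "val(M) ≤ Σ_i val(M_i)")] -/
theorem val_sum_le {ι : Type*} (s : Finset ι) (Ms : ι → Cube n → Cube n → ℝ) :
    val (fun a b => ∑ t ∈ s, Ms t a b) ≤ ∑ t ∈ s, val (Ms t) := by
  classical
  unfold val
  calc (univ.filter fun p : Cube n × Cube n => ip p.1 p.2 = 0 ∧ 0 < ∑ t ∈ s, Ms t p.1 p.2).card
      ≤ (s.biUnion fun t => univ.filter fun p : Cube n × Cube n =>
          ip p.1 p.2 = 0 ∧ 0 < Ms t p.1 p.2).card := by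
        refine Finset.card_le_card fun p hp => ?_
        rw [Finset.mem_filter] at hp
        obtain ⟨-, hip, hpos⟩ := hp
        obtain ⟨t, ht, htpos⟩ : ∃ t ∈ s, 0 < Ms t p.1 p.2 := by
          by_contra hcon
          push Not at hcon
          exact absurd (Finset.sum_nonpos hcon) (not_le.2 hpos)
        exact Finset.mem_biUnion.2 ⟨t, ht, Finset.mem_filter.2 ⟨Finset.mem_univ _, hip, htpos⟩⟩
    _ ≤ ∑ t ∈ s, (univ.filter fun p : Cube n × Cube n => ip p.1 p.2 = 0 ∧ 0 < Ms t p.1 p.2).card :=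
        Finset.card_biUnion_le

/-- A factorization of a nonnegative matrix `M` through the cone `(S^d_+)^r` (`r` blocks of size `d`):
`M_{ij} = Σ_{t<r} tr(A_{i,t} B_{j,t})`, all `A_{i,t}, B_{j,t} ∈ S^d_+` — equivalently `M = M_1 + ⋯ + M_r` with
`rank_psd(M_t) ≤ d`; by the cone-factorization theorem (FP13 Thm. 2 = Gouveia–Parrilo–Thomas) a polytope has
an `(S^d_+)^r`-lift iff its slack matrix has such a factorization; `(S^d_+)^r ⊆ S^{rd}_+`.
[cite: FawziParrilo2013, §1.2 (p. 5, "Strategy of proof") and Thm. 2 (§2.1, p. 6)] -/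
def HasPsdPowerFactorization {ι κ : Type*} (M : ι → κ → ℝ) (d r : ℕ) : Prop :=
  ∃ (A : ι → Fin r → Matrix (Fin d) (Fin d) ℝ) (B : κ → Fin r → Matrix (Fin d) (Fin d) ℝ),
    (∀ i t, (A i t).PosSemidef) ∧ (∀ j t, (B j t).PosSemidef) ∧
    ∀ i j, M i j = ∑ t, (A i t * B j t).trace

/-- One block: `(S^d_+)^1`-factorizations are `S^d_+`-factorizations. [cite: FawziParrilo2013, §1.1 (p. 3)] -/
theorem hasPsdPowerFactorization_one_iff {ι κ : Type*} {M : ι → κ → ℝ} {d : ℕ} :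
    HasPsdPowerFactorization M d 1 ↔ HasPsdFactorization M d := by
  constructor
  · rintro ⟨A, B, hA, hB, hM⟩
    refine ⟨fun i => A i 0, fun j => B j 0, fun i => hA i 0, fun j => hB j 0, fun i j => ?_⟩
    rw [hM, Fintype.sum_unique]
    rfl
  · rintro ⟨U, V, hU, hV, hM⟩
    refine ⟨fun i _ => U i, fun j _ => V j, fun i _ => hU i, fun j _ => hV j, fun i j => ?_⟩
    rw [hM, Fintype.sum_unique]

/-- **`d = 1`: LP lifts.** `(S^1_+)^r`-factorizations are exactly nonnegative factorizations `M = Σ_{t<r} a_t b_tᵀ`,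
`a_t, b_t ≥ 0`, of size `r` ("LP extended formulations are captured by the case `d = 1`").
[cite: FawziParrilo2013, §1.2 (p. 4)] -/
theorem hasPsdPowerFactorization_one_iff_nonneg {ι κ : Type*} {M : ι → κ → ℝ} {r : ℕ} :
    HasPsdPowerFactorization M 1 r ↔
      ∃ (a : ι → Fin r → ℝ) (b : κ → Fin r → ℝ), (∀ i t, 0 ≤ a i t) ∧ (∀ j t, 0 ≤ b j t) ∧
        ∀ i j, M i j = ∑ t, a i t * b j t := by
  constructor
  · rintro ⟨A, B, hA, hB, hM⟩
    refine ⟨fun i t => A i t 0 0, fun j t => B j t 0 0, fun i t => (hA i t).diag_nonneg,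
      fun j t => (hB j t).diag_nonneg, fun i j => ?_⟩
    rw [hM]
    refine Finset.sum_congr rfl fun t _ => ?_
    rw [Matrix.trace_fin_one, Matrix.mul_apply, Fintype.sum_unique]
    rfl
  · rintro ⟨a, b, ha, hb, hM⟩
    refine ⟨fun i t => a i t • (1 : Matrix (Fin 1) (Fin 1) ℝ), fun j t => b j t • (1 : Matrix (Fin 1) (Fin 1) ℝ),
      fun i t => Matrix.PosSemidef.one.smul (ha i t), fun j t => Matrix.PosSemidef.one.smul (hb j t),
      fun i j => ?_⟩
    rw [hM]
    refine Finset.sum_congr rfl fun t _ => ?_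
    rw [Matrix.smul_mul, Matrix.mul_smul, Matrix.one_mul, Matrix.trace_smul, Matrix.trace_smul,
      Matrix.trace_one, Fintype.card_fin, Nat.cast_one, smul_eq_mul, smul_eq_mul, mul_one, mul_comm]

/-- Restriction to a submatrix. [cite: FawziParrilo2013, §2.1 (p. 6, "UDISJ(n) is a submatrix of the slack matrix")] -/
theorem HasPsdPowerFactorization.submatrix {ι κ ι' κ' : Type*} {M : ι → κ → ℝ} {d r : ℕ}
    (h : HasPsdPowerFactorization M d r) (f : ι' → ι) (g : κ' → κ) :
    HasPsdPowerFactorization (fun i j => M (f i) (g j)) d r := by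
  obtain ⟨A, B, hA, hB, hM⟩ := h
  exact ⟨fun i => A (f i), fun j => B (g j), fun i t => hA _ _, fun j t => hB _ _, fun i j => hM _ _⟩

/-- More blocks (padding with zero blocks): `(S^d_+)^r`-factorizations are `(S^d_+)^s`-factorizations, `r ≤ s`.
[cite: FawziParrilo2013, §1.1 (p. 3)] -/
theorem HasPsdPowerFactorization.mono_blocks {ι κ : Type*} {M : ι → κ → ℝ} {d r s : ℕ}
    (h : HasPsdPowerFactorization M d r) (hrs : r ≤ s) : HasPsdPowerFactorization M d s := by
  obtain ⟨A, B, hA, hB, hM⟩ := h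
  obtain ⟨e, rfl⟩ := Nat.exists_eq_add_of_le hrs
  refine ⟨fun i => Fin.append (A i) (fun _ : Fin e => (0 : Matrix (Fin d) (Fin d) ℝ)),
    fun j => Fin.append (B j) (fun _ : Fin e => (0 : Matrix (Fin d) (Fin d) ℝ)),
    fun i t => ?_, fun j t => ?_, fun i j => ?_⟩
  · refine Fin.addCases (fun t => ?_) (fun t => ?_) t
    · change (Fin.append (A i) (fun _ : Fin e => (0 : Matrix (Fin d) (Fin d) ℝ)) (Fin.castAdd e t)).PosSemidef
      rw [Fin.append_left]; exact hA i t
    · change (Fin.append (A i) (fun _ : Fin e => (0 : Matrix (Fin d) (Fin d) ℝ)) (Fin.natAdd r t)).PosSemidef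
      rw [Fin.append_right]; exact Matrix.PosSemidef.zero
  · refine Fin.addCases (fun t => ?_) (fun t => ?_) t
    · change (Fin.append (B j) (fun _ : Fin e => (0 : Matrix (Fin d) (Fin d) ℝ)) (Fin.castAdd e t)).PosSemidef
      rw [Fin.append_left]; exact hB j t
    · change (Fin.append (B j) (fun _ : Fin e => (0 : Matrix (Fin d) (Fin d) ℝ)) (Fin.natAdd r t)).PosSemidef
      rw [Fin.append_right]; exact Matrix.PosSemidef.zero
  · rw [hM, Fin.sum_univ_add]
    simp

/-- Trace is invariant under reindexing rows and columns by one equivalence. [cite: FawziParrilo2013, §1.1 (p. 3)] -/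
private theorem trace_submatrix_equiv' {p q : Type*} [Fintype p] [Fintype q] (X : Matrix q q ℝ)
    (e : p ≃ q) : (X.submatrix e e).trace = X.trace := by
  simp only [Matrix.trace, Matrix.diag, submatrix_apply]
  exact Fintype.sum_equiv e _ _ fun _ => rfl

open Literature.Analysis.Convex.FrictionConeLMI in
/-- **`(S^d_+)^r ⊆ S^{rd}_+`**: an `(S^d_+)^r`-factorization is an `S^{dr}_+`-factorization (block-diagonal
embedding) — "any `(S^d_+)^r`-lift of `P` is an `S^{rd}_+`-lift; as such, lower bounds on the size of `(S^d_+)^r`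
lifts can be obtained from lower bounds on PSD-lifts [but the converse is loose]". [cite: FawziParrilo2013, §1.1 (p. 3)] -/
theorem HasPsdPowerFactorization.hasPsdFactorization {ι κ : Type*} {M : ι → κ → ℝ} {d r : ℕ}
    (h : HasPsdPowerFactorization M d r) : HasPsdFactorization M (d * r) := by
  classical
  obtain ⟨A, B, hA, hB, hM⟩ := h
  let e : Fin (d * r) ≃ Fin d × Fin r := finProdFinEquiv.symm
  refine ⟨fun i => (blockDiagonal (A i)).submatrix e e, fun j => (blockDiagonal (B j)).submatrix e e,
    fun i => ((posSemidef_blockDiagonal_iff _).2 (hA i)).submatrix e,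
    fun j => ((posSemidef_blockDiagonal_iff _).2 (hB j)).submatrix e, fun i j => ?_⟩
  rw [submatrix_mul_equiv, trace_submatrix_equiv', ← blockDiagonal_mul, trace_blockDiagonal, hM]

/-- `k`-uniform covering of `𝒜_{S^d_+}(d)` ⇒ `3ⁿ ≤ r · k^{⌊(n−1)/d⌋+1}` for every `(S^d_+)^r`-factorization
of `UDISJ(n)`, `n ≥ d ≥ 1` (Thm. 3 + subadditivity + `val(UDISJ(n)) = 3ⁿ`).
[cite: FawziParrilo2013, Thm. 3 (§2.3, p. 9) and §2.2 (pp. 7–8)] -/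
theorem three_pow_le_of_hasUniformCovering {n d k r : ℕ} (hd : 1 ≤ d) (hnd : d ≤ n)
    (hcov : HasUniformCovering d k {B : Cube d → Cube d → ℝ | IsAtom d B})
    (h : HasPsdPowerFactorization (udisj n) d r) :
    3 ^ n ≤ r * k ^ ((n - 1) / d + 1) := by
  classical
  obtain ⟨A, B, hA, hB, hM⟩ := h
  let Ms : Fin r → Cube n → Cube n → ℝ := fun t a b => (A a t * B b t).trace
  have hnn : ∀ t a b, 0 ≤ Ms t a b := fun t a b =>
    Literature.Computation.Certificates.SemidefiniteComplementarity.frob_nonneg_of_posSemidef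
      (hA a t) (hB b t)
  have hatom : ∀ t, IsAtom d (Ms t) := by
    intro t
    refine ⟨⟨fun a => A a t, fun b => B b t, fun a => hA a t, fun b => hB b t, fun a b => rfl⟩,
      fun a b hab => ?_⟩
    have hsum : ∑ s, Ms s a b = 0 := by
      change ∑ s, (A a s * B b s).trace = 0
      rw [← hM a b]
      simp [udisj, hab]
    exact (Finset.sum_eq_zero_iff_of_nonneg fun s _ => hnn s a b).1 hsum t (Finset.mem_univ _)
  have hval : val (udisj n) = val (fun a b => ∑ t ∈ (univ : Finset (Fin r)), Ms t a b) := by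
    congr 1
    funext a b
    exact hM a b
  calc 3 ^ n = val (udisj n) := (val_udisj n).symm
    _ = val (fun a b => ∑ t ∈ (univ : Finset (Fin r)), Ms t a b) := hval
    _ ≤ ∑ t ∈ (univ : Finset (Fin r)), val (Ms t) := val_sum_le _ _
    _ ≤ ∑ _t : Fin r, k ^ ((n - 1) / d + 1) :=
        Finset.sum_le_sum fun t _ => val_le_pow hd hcov n hnd (Ms t) (hatom t)
    _ = r * k ^ ((n - 1) / d + 1) := by simp

/-- **Fawzi–Parrilo, Corollary 1 / eq. (9).** For `n ≥ d ≥ 1`: if `UDISJ(n)` factors through `(S^d_+)^r`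
then `3ⁿ ≤ r · (3^d − 1)^{⌊(n−1)/d⌋+1}`, i.e. `rank_{S^d_+}(UDISJ(n)) ≥ 3ⁿ/(3^d−1)^{⌊(n−1)/d⌋+1}`
(each term is an atom of `𝒜_{S^d_+}(n)`, so has `val ≤ (3^d−1)^{⌊(n−1)/d⌋+1}` by Thm. 3 + Thm. 5, and
`val` is subadditive with `val(UDISJ(n)) = 3ⁿ`). [cite: FawziParrilo2013, Cor. 1 and eq. (9) (§2.5, p. 11)] -/
theorem three_pow_le_of_hasPsdPowerFactorization_udisj {n d r : ℕ} (hd : 1 ≤ d) (hnd : d ≤ n)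
    (h : HasPsdPowerFactorization (udisj n) d r) :
    3 ^ n ≤ r * (3 ^ d - 1) ^ ((n - 1) / d + 1) :=
  three_pow_le_of_hasUniformCovering hd hnd (hasUniformCovering_atoms d) h

/-! ### F6. The `(S^d_+)^r`-extension complexity of the correlation polytope (FP13 Theorem 1) -/

/-- The quadratic form `Σ_{ij} (2[i=j]v_i − v_i v_j) x_i x_j = 2·Σ v_i x_i − (Σ v_i x_i)²` on `0/1` points.
[cite: FawziParrilo2013, §2.1 (p. 5–6, "UDISJ(n) is a submatrix of the slack matrix of COR(n)")] -/
theorem quadForm_eq (v x : Fin n → ℝ) (hx : ∀ i, x i = 0 ∨ x i = 1) :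
    ∑ i, ∑ j, ((if i = j then 2 * v i else 0) - v i * v j) * (x i * x j)
      = 2 * (∑ i, v i * x i) - (∑ i, v i * x i) ^ 2 := by
  have hxx : ∀ i, x i * x i = x i := fun i => by rcases hx i with h | h <;> simp [h]
  simp only [sub_mul, Finset.sum_sub_distrib]
  congr 1
  · rw [Finset.mul_sum]
    refine Finset.sum_congr rfl fun i _ => ?_
    simp only [ite_mul, zero_mul, Finset.sum_ite_eq, Finset.mem_univ, if_true, hxx]
    ring
  · rw [sq, Finset.sum_mul_sum]
    exact Finset.sum_congr rfl fun i _ => Finset.sum_congr rfl fun j _ => by ring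

/-- `aᵀb` over `ℝ` for bit strings. [cite: FawziParrilo2013, Def. 3 (§2.1, p. 6)] -/
theorem ip_cast (a b : Cube n) :
    (ip a b : ℝ) = ∑ i, (if a i = true then (1 : ℝ) else 0) * (if b i = true then 1 else 0) := by
  rw [ip_eq_sum]
  push_cast
  refine Finset.sum_congr rfl fun i _ => ?_
  by_cases ha : a i = true <;> by_cases hb : b i = true <;> simp [ha, hb]


/-! ### F7. The case `d = 2` (FP13 §2.4): six sparsity patterns and a `7`-uniform covering -/

/-- The bit string `b₀b₁ ∈ {0,1}²`. [cite: FawziParrilo2013, §2.4 (p. 9, "00, 01, 10, 11")] -/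
def s2 (b0 b1 : Bool) : Cube 2 := ![b0, b1]

/-- Every `z ∈ {0,1}²` is `z₀z₁`. [cite: FawziParrilo2013, §2.4 (p. 9)] -/
theorem s2_eta (z : Cube 2) : z = s2 (z 0) (z 1) := by
  funext i
  fin_cases i <;> rfl

/-- Disjointness of `a₀a₁` and `b₀b₁` on bits. [cite: FawziParrilo2013, §2.4 (p. 9)] -/
def disjBits (a0 a1 b0 b1 : Bool) : Bool := !(a0 && b0) && !(a1 && b1)

/-- `(a₀a₁)ᵀ(b₀b₁)` on bits. [cite: FawziParrilo2013, Def. 3 (§2.1, p. 6)] -/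
theorem ip_s2 (a0 a1 b0 b1 : Bool) :
    ip (s2 a0 a1) (s2 b0 b1) =
      (if a0 = true ∧ b0 = true then 1 else 0) + (if a1 = true ∧ b1 = true then 1 else 0) := by
  rw [ip_eq_sum, Fin.sum_univ_two]
  rfl

/-- `(a₀a₁)ᵀ(b₀b₁) = 0 ↔ disjBits`. [cite: FawziParrilo2013, §2.4 (p. 9)] -/
theorem ip_s2_eq_zero_iff (a0 a1 b0 b1 : Bool) :
    ip (s2 a0 a1) (s2 b0 b1) = 0 ↔ disjBits a0 a1 b0 b1 = true := by
  rw [ip_s2]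
  cases a0 <;> cases a1 <;> cases b0 <;> cases b1 <;> decide

/-- `zᵀw = 0 ↔ disjBits` for `z, w ∈ {0,1}²`. [cite: FawziParrilo2013, §2.4 (p. 9)] -/
theorem ip_eq_zero_iff_disjBits (z w : Cube 2) :
    ip z w = 0 ↔ disjBits (z 0) (z 1) (w 0) (w 1) = true := by
  conv_lhs => rw [s2_eta z, s2_eta w]
  exact ip_s2_eq_zero_iff _ _ _ _

/-- The (disjoint-pair) zeros of the six sparsity patterns of Lemma 2, on bits `(a₀, a₁, b₀, b₁)` of an entry
`(a₀a₁, b₀b₁)`: (1) `M_{01,10} = M_{10,01} = 0`; (2) `M_{11,00} = M_{00,11} = 0`; (3) row `01` zero;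
(4) row `10` zero; (5) column `01` zero; (6) column `10` zero. [cite: FawziParrilo2013, Lemma 2 (§2.4, p. 9)] -/
def patZero (π : Fin 6) (a0 a1 b0 b1 : Bool) : Bool :=
  match π.val, a0, a1, b0, b1 with
  | 0, false, true, true, false => true
  | 0, true, false, false, true => true
  | 1, true, true, false, false => true
  | 1, false, false, true, true => true
  | 2, false, true, false, false => true
  | 2, false, true, true, false => true
  | 3, true, false, false, false => true
  | 3, true, false, false, true => true
  | 4, false, false, false, true => true
  | 4, true, false, false, true => true
  | 5, false, false, true, false => true
  | 5, false, true, true, false => true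
  | _, _, _, _, _ => false

/-- Row sets of the seven rectangles `R_1 = 𝔞 = {00} × {00,01,10,11}`, `R_2 = R_3 = 𝔟 = {00,01,10,11} × {00}`,
`R_4 = R_5 = 𝔠 = {00,01} × {00,10}`, `R_6 = R_7 = 𝔡 = {00,10} × {00,01}`, on bits.
[cite: FawziParrilo2013, §2.4 (p. 10, display defining 𝔞, 𝔟, 𝔠, 𝔡 and R_1, …, R_7)] -/
def memI (t : Fin 7) (z0 z1 : Bool) : Bool :=
  match t.val with
  | 0 => !z0 && !z1
  | 1 => true
  | 2 => true
  | 3 => !z0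
  | 4 => !z0
  | 5 => !z1
  | _ => !z1

/-- Column sets of the seven rectangles (see `memI`). [cite: FawziParrilo2013, §2.4 (p. 10)] -/
def memJ (t : Fin 7) (w0 w1 : Bool) : Bool :=
  match t.val with
  | 0 => true
  | 1 => !w0 && !w1
  | 2 => !w0 && !w1
  | 3 => !w1
  | 4 => !w1
  | 5 => !w0
  | _ => !w0

/-- The maps `φ` (one per sparsity pattern) sending the possibly-nonzero disjoint pairs injectively to
rectangles containing them (FP13 gives them in a figure; this is one valid choice).
[cite: FawziParrilo2013, §2.4 (p. 10, "we provide the map φ for the 6 possible sparsity patterns")] -/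
def tbl (π : Fin 6) (a0 a1 b0 b1 : Bool) : Fin 7 :=
  match π.val, a0, a1, b0, b1 with
  -- pattern (1)
  | 0, false, false, true, true => 0
  | 0, true, true, false, false => 1
  | 0, false, false, false, true => 5
  | 0, false, false, true, false => 3
  | 0, false, true, false, false => 4
  | 0, true, false, false, false => 6
  | 0, false, false, false, false => 2
  -- pattern (2)
  | 1, false, true, true, false => 3
  | 1, true, false, false, true => 5
  | 1, false, false, false, true => 6
  | 1, false, false, true, false => 4
  | 1, false, true, false, false => 1
  | 1, true, false, false, false => 2
  | 1, false, false, false, false => 0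
  -- pattern (3)
  | 2, false, false, true, true => 0
  | 2, true, true, false, false => 1
  | 2, true, false, false, true => 5
  | 2, false, false, false, true => 6
  | 2, false, false, true, false => 3
  | 2, true, false, false, false => 2
  | 2, false, false, false, false => 4
  -- pattern (4)
  | 3, false, false, true, true => 0
  | 3, true, true, false, false => 1
  | 3, false, true, true, false => 3
  | 3, false, false, false, true => 5
  | 3, false, false, true, false => 4
  | 3, false, true, false, false => 2
  | 3, false, false, false, false => 6
  -- pattern (5)
  | 4, false, false, true, true => 0
  | 4, true, true, false, false => 1
  | 4, false, true, true, false => 3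
  | 4, false, false, true, false => 4
  | 4, false, true, false, false => 2
  | 4, true, false, false, false => 5
  | 4, false, false, false, false => 6
  -- pattern (6)
  | 5, false, false, true, true => 0
  | 5, true, true, false, false => 1
  | 5, true, false, false, true => 5
  | 5, false, false, false, true => 6
  | 5, false, true, false, false => 3
  | 5, true, false, false, false => 2
  | 5, false, false, false, false => 4
  | _, _, _, _, _ => 0

/-- The rectangles are supported on disjoint pairs. [cite: FawziParrilo2013, §2.4 (p. 10)] -/
theorem memI_memJ_disj : ∀ t : Fin 7, ∀ z0 z1 w0 w1 : Bool,
    memI t z0 z1 = true → memJ t w0 w1 = true → disjBits z0 z1 w0 w1 = true := by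
  decide

/-- `φ` lands in rectangles containing the entry. [cite: FawziParrilo2013, §2.4 (p. 10)] -/
theorem tbl_mem : ∀ π : Fin 6, ∀ a0 a1 b0 b1 : Bool,
    disjBits a0 a1 b0 b1 = true → patZero π a0 a1 b0 b1 = false →
      memI (tbl π a0 a1 b0 b1) a0 a1 = true ∧ memJ (tbl π a0 a1 b0 b1) b0 b1 = true := by
  decide

/-- `φ` is injective on the possibly-nonzero disjoint pairs. [cite: FawziParrilo2013, §2.4 (p. 10)] -/
theorem tbl_inj : ∀ π : Fin 6, ∀ a0 a1 b0 b1 c0 c1 d0 d1 : Bool,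
    disjBits a0 a1 b0 b1 = true → patZero π a0 a1 b0 b1 = false →
    disjBits c0 c1 d0 d1 = true → patZero π c0 c1 d0 d1 = false →
    tbl π a0 a1 b0 b1 = tbl π c0 c1 d0 d1 → a0 = c0 ∧ a1 = c1 ∧ b0 = d0 ∧ b1 = d1 := by
  decide

/-- Two distinct subspaces of `ℝ²` not spanning `ℝ²`: one of them is `0`.
[cite: FawziParrilo2013, proof of Lemma 2 (§2.4, p. 10: "since 𝒰₁₀ ≠ 𝒰₀₁ we have necessarily either 𝒰₁₀ = {0} or 𝒰₀₁ = {0}")] -/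
theorem eq_bot_or_eq_bot_of_sup_ne_top {W₁ W₂ : Submodule ℝ (Fin 2 → ℝ)} (hne : W₁ ≠ W₂)
    (hsup : W₁ ⊔ W₂ ≠ ⊤) : W₁ = ⊥ ∨ W₂ = ⊥ := by
  by_contra hcon
  push Not at hcon
  have hlt : Module.finrank ℝ ↥(W₁ ⊔ W₂) < 2 := by
    have := Submodule.finrank_lt_finrank_of_lt (lt_top_iff_ne_top.2 hsup)
    simpa using this
  have h1 : 1 ≤ Module.finrank ℝ W₁ := by
    rw [Nat.one_le_iff_ne_zero, Ne, Submodule.finrank_eq_zero]; exact hcon.1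
  have h2 : 1 ≤ Module.finrank ℝ W₂ := by
    rw [Nat.one_le_iff_ne_zero, Ne, Submodule.finrank_eq_zero]; exact hcon.2
  have hle1 : Module.finrank ℝ W₁ ≤ Module.finrank ℝ ↥(W₁ ⊔ W₂) := Submodule.finrank_mono le_sup_left
  have hle2 : Module.finrank ℝ W₂ ≤ Module.finrank ℝ ↥(W₁ ⊔ W₂) := Submodule.finrank_mono le_sup_right
  have e1 : W₁ = W₁ ⊔ W₂ := Submodule.eq_of_le_of_finrank_eq le_sup_left (by omega)
  have e2 : W₂ = W₁ ⊔ W₂ := Submodule.eq_of_le_of_finrank_eq le_sup_right (by omega)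
  exact hne (e1.trans e2.symm)

/-- From pattern zeros at the bit level to the statement about `M`. [cite: FawziParrilo2013, Lemma 2 (§2.4, p. 9)] -/
private theorem pattern_of (π : Fin 6) (M : Cube 2 → Cube 2 → ℝ)
    (h : ∀ a0 a1 b0 b1, patZero π a0 a1 b0 b1 = true → M (s2 a0 a1) (s2 b0 b1) = 0) :
    ∀ z w : Cube 2, patZero π (z 0) (z 1) (w 0) (w 1) = true → M z w = 0 := by
  intro z w hzw
  rw [s2_eta z, s2_eta w]
  exact h _ _ _ _ hzw

open Literature.Computation.Certificates.SemidefiniteComplementarity in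
/-- **Fawzi–Parrilo, Lemma 2.** "Any `4 × 4` matrix `M ∈ 𝒜_{S²_+}(2)` has one of the following six sparsity
patterns" — beyond the default zeros (`aᵀb = 1`): (1) `M_{01,10} = M_{10,01} = 0`, (2) `M_{11,00} = M_{00,11} = 0`,
(3)/(4) row `01`/`10` zero, (5)/(6) column `01`/`10` zero; "In particular `val(M) ≤ 7`."  Printed proof: with
`𝒰_a = Im U_a`, `𝒱_b = Im V_b ⊆ ℝ²`, either `𝒱₀₁ = 𝒱₁₀` (or `𝒰₀₁ = 𝒰₁₀`) ⇒ (1); or both sums are `ℝ²` ⇒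
`U₁₁ = V₁₁ = 0` ⇒ (2); or a sum is a line ⇒ one image is `0` ⇒ a zero row/column.
[cite: FawziParrilo2013, Lemma 2 (§2.4, pp. 9–10)] -/
theorem exists_pattern {M : Cube 2 → Cube 2 → ℝ} (hM : IsAtom 2 M) :
    ∃ π : Fin 6, ∀ z w : Cube 2, patZero π (z 0) (z 1) (w 0) (w 1) = true → M z w = 0 := by
  classical
  obtain ⟨⟨U, V, hU, hV, hUV⟩, hzero⟩ := hM
  let f : Cube 2 → (Fin 2 → ℝ) →ₗ[ℝ] (Fin 2 → ℝ) := fun a => Matrix.toLin' (U a)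
  let g : Cube 2 → (Fin 2 → ℝ) →ₗ[ℝ] (Fin 2 → ℝ) := fun b => Matrix.toLin' (V b)
  have hiffV : ∀ a b, M a b = 0 ↔ LinearMap.range (g b) ≤ LinearMap.ker (f a) := by
    intro a b
    rw [LinearMap.range_le_ker_iff, hUV a b]
    change _ ↔ Matrix.toLin' (U a) ∘ₗ Matrix.toLin' (V b) = 0
    rw [← Matrix.toLin'_mul, LinearEquiv.map_eq_zero_iff]
    exact trace_mul_eq_zero_iff (hU a) (hV b)
  have hiffU : ∀ a b, M a b = 0 ↔ LinearMap.range (f a) ≤ LinearMap.ker (g b) := by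
    intro a b
    rw [LinearMap.range_le_ker_iff, hUV a b, ← Matrix.trace_mul_comm]
    change _ ↔ Matrix.toLin' (V b) ∘ₗ Matrix.toLin' (U a) = 0
    rw [← Matrix.toLin'_mul, LinearEquiv.map_eq_zero_iff]
    exact trace_mul_eq_zero_iff (hV b) (hU a)
  have hrowU : ∀ a, LinearMap.range (f a) = ⊥ → ∀ w, M a w = 0 := by
    intro a ha w
    have : U a = 0 := (LinearEquiv.map_eq_zero_iff Matrix.toLin').1 (LinearMap.range_eq_bot.1 ha)
    rw [hUV, this, Matrix.zero_mul, Matrix.trace_zero]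
  have hcolV : ∀ b, LinearMap.range (g b) = ⊥ → ∀ z, M z b = 0 := by
    intro b hb z
    have : V b = 0 := (LinearEquiv.map_eq_zero_iff Matrix.toLin').1 (LinearMap.range_eq_bot.1 hb)
    rw [hUV, this, Matrix.mul_zero, Matrix.trace_zero]
  -- default zeros
  have z0101 : M (s2 false true) (s2 false true) = 0 := hzero _ _ (by rw [ip_s2]; decide)
  have z1010 : M (s2 true false) (s2 true false) = 0 := hzero _ _ (by rw [ip_s2]; decide)
  have z0111 : M (s2 false true) (s2 true true) = 0 := hzero _ _ (by rw [ip_s2]; decide)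
  have z1011 : M (s2 true false) (s2 true true) = 0 := hzero _ _ (by rw [ip_s2]; decide)
  have z1101 : M (s2 true true) (s2 false true) = 0 := hzero _ _ (by rw [ip_s2]; decide)
  have z1110 : M (s2 true true) (s2 true false) = 0 := hzero _ _ (by rw [ip_s2]; decide)
  -- a small tactic-free dispatcher: check the pattern on the 16 bit tuples
  have mk : ∀ π : Fin 6, ∀ P : Bool → Bool → Bool → Bool → Prop,
      (∀ a0 a1 b0 b1, P a0 a1 b0 b1 → M (s2 a0 a1) (s2 b0 b1) = 0) →
      (∀ a0 a1 b0 b1, patZero π a0 a1 b0 b1 = true → P a0 a1 b0 b1) →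
      ∃ π : Fin 6, ∀ z w : Cube 2, patZero π (z 0) (z 1) (w 0) (w 1) = true → M z w = 0 :=
    fun π P hP hπ => ⟨π, pattern_of π M fun a0 a1 b0 b1 h => hP _ _ _ _ (hπ _ _ _ _ h)⟩
  by_cases hA : LinearMap.range (g (s2 false true)) = LinearMap.range (g (s2 true false))
  · -- pattern (1) from `𝒱₀₁ = 𝒱₁₀`
    have h1 : M (s2 false true) (s2 true false) = 0 :=
      (hiffV _ _).2 (hA.symm.le.trans ((hiffV _ _).1 z0101))
    have h2 : M (s2 true false) (s2 false true) = 0 :=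
      (hiffV _ _).2 (hA.le.trans ((hiffV _ _).1 z1010))
    refine mk 0 (fun a0 a1 b0 b1 => (a0 = false ∧ a1 = true ∧ b0 = true ∧ b1 = false) ∨
        (a0 = true ∧ a1 = false ∧ b0 = false ∧ b1 = true)) ?_ ?_
    · rintro a0 a1 b0 b1 (⟨rfl, rfl, rfl, rfl⟩ | ⟨rfl, rfl, rfl, rfl⟩); exacts [h1, h2]
    · decide
  by_cases hA' : LinearMap.range (f (s2 false true)) = LinearMap.range (f (s2 true false))
  · -- pattern (1) from `𝒰₀₁ = 𝒰₁₀`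
    have h1 : M (s2 false true) (s2 true false) = 0 :=
      (hiffU _ _).2 (hA'.le.trans ((hiffU _ _).1 z1010))
    have h2 : M (s2 true false) (s2 false true) = 0 :=
      (hiffU _ _).2 (hA'.symm.le.trans ((hiffU _ _).1 z0101))
    refine mk 0 (fun a0 a1 b0 b1 => (a0 = false ∧ a1 = true ∧ b0 = true ∧ b1 = false) ∨
        (a0 = true ∧ a1 = false ∧ b0 = false ∧ b1 = true)) ?_ ?_
    · rintro a0 a1 b0 b1 (⟨rfl, rfl, rfl, rfl⟩ | ⟨rfl, rfl, rfl, rfl⟩); exacts [h1, h2]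
    · decide
  by_cases hB : LinearMap.range (f (s2 false true)) ⊔ LinearMap.range (f (s2 true false)) = ⊤
  · by_cases hB' : LinearMap.range (g (s2 false true)) ⊔ LinearMap.range (g (s2 true false)) = ⊤
    · -- pattern (2): `U₁₁ = V₁₁ = 0`
      have hg : LinearMap.range (g (s2 true true)) = ⊥ := by
        have hk : LinearMap.ker (g (s2 true true)) = ⊤ := by
          rw [eq_top_iff, ← hB]
          exact sup_le ((hiffU _ _).1 z0111) ((hiffU _ _).1 z1011)
        rw [LinearMap.range_eq_bot, ← LinearMap.ker_eq_top]; exact hk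
      have hf : LinearMap.range (f (s2 true true)) = ⊥ := by
        have hk : LinearMap.ker (f (s2 true true)) = ⊤ := by
          rw [eq_top_iff, ← hB']
          exact sup_le ((hiffV _ _).1 z1101) ((hiffV _ _).1 z1110)
        rw [LinearMap.range_eq_bot, ← LinearMap.ker_eq_top]; exact hk
      have h1 : M (s2 true true) (s2 false false) = 0 := hrowU _ hf _
      have h2 : M (s2 false false) (s2 true true) = 0 := hcolV _ hg _
      refine mk 1 (fun a0 a1 b0 b1 => (a0 = true ∧ a1 = true ∧ b0 = false ∧ b1 = false) ∨
          (a0 = false ∧ a1 = false ∧ b0 = true ∧ b1 = true)) ?_ ?_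
      · rintro a0 a1 b0 b1 (⟨rfl, rfl, rfl, rfl⟩ | ⟨rfl, rfl, rfl, rfl⟩); exacts [h1, h2]
      · decide
    · -- a zero column: patterns (5)/(6)
      rcases eq_bot_or_eq_bot_of_sup_ne_top hA hB' with h | h
      · refine mk 4 (fun a0 a1 b0 b1 => b0 = false ∧ b1 = true) ?_ ?_
        · rintro a0 a1 b0 b1 ⟨rfl, rfl⟩; exact hcolV _ h _
        · decide
      · refine mk 5 (fun a0 a1 b0 b1 => b0 = true ∧ b1 = false) ?_ ?_
        · rintro a0 a1 b0 b1 ⟨rfl, rfl⟩; exact hcolV _ h _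
        · decide
  · -- a zero row: patterns (3)/(4)
    rcases eq_bot_or_eq_bot_of_sup_ne_top hA' hB with h | h
    · refine mk 2 (fun a0 a1 b0 b1 => a0 = false ∧ a1 = true) ?_ ?_
      · rintro a0 a1 b0 b1 ⟨rfl, rfl⟩; exact hrowU _ h _
      · decide
    · refine mk 3 (fun a0 a1 b0 b1 => a0 = true ∧ a1 = false) ?_ ?_
      · rintro a0 a1 b0 b1 ⟨rfl, rfl⟩; exact hrowU _ h _
      · decide

/-- **Fawzi–Parrilo, Theorem 4.** `𝒜_{S²_+}(2)` has a `k`-uniform covering with `k = 7` (rectangles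
`𝔞, 𝔟, 𝔟, 𝔠, 𝔠, 𝔡, 𝔡`). [cite: FawziParrilo2013, Thm. 4 (§2.4, pp. 9–10)] -/
theorem hasUniformCovering_atoms_two : HasUniformCovering 2 7 {B : Cube 2 → Cube 2 → ℝ | IsAtom 2 B} := by
  classical
  refine ⟨fun t => univ.filter fun z : Cube 2 => memI t (z 0) (z 1) = true,
    fun t => univ.filter fun w : Cube 2 => memJ t (w 0) (w 1) = true, fun t x hx y hy => ?_, fun M hM => ?_⟩
  · simp only [Finset.mem_filter, Finset.mem_univ, true_and] at hx hy
    exact (ip_eq_zero_iff_disjBits x y).2 (memI_memJ_disj t _ _ _ _ hx hy)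
  · obtain ⟨π, hπ⟩ := exists_pattern hM
    have hcand : ∀ p : {p : Cube 2 × Cube 2 // ip p.1 p.2 = 0 ∧ 0 < M p.1 p.2},
        disjBits (p.1.1 0) (p.1.1 1) (p.1.2 0) (p.1.2 1) = true ∧
          patZero π (p.1.1 0) (p.1.1 1) (p.1.2 0) (p.1.2 1) = false := by
      intro p
      refine ⟨(ip_eq_zero_iff_disjBits _ _).1 p.2.1, ?_⟩
      cases h : patZero π (p.1.1 0) (p.1.1 1) (p.1.2 0) (p.1.2 1)
      · rfl
      · exact absurd (hπ _ _ h) (ne_of_gt p.2.2)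
    refine ⟨fun p => tbl π (p.1.1 0) (p.1.1 1) (p.1.2 0) (p.1.2 1), fun p q hpq => ?_, fun p => ?_⟩
    · obtain ⟨h1, h2, h3, h4⟩ :=
        tbl_inj π _ _ _ _ _ _ _ _ (hcand p).1 (hcand p).2 (hcand q).1 (hcand q).2 hpq
      apply Subtype.ext
      refine Prod.ext ?_ ?_
      · rw [s2_eta p.1.1, s2_eta q.1.1, h1, h2]
      · rw [s2_eta p.1.2, s2_eta q.1.2, h3, h4]
    · simp only [Finset.mem_filter, Finset.mem_univ, true_and]
      exact tbl_mem π _ _ _ _ (hcand p).1 (hcand p).2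

/-- **Fawzi–Parrilo, §2.4 (display after Thm. 4).** "`rank_{S²_+}(UDISJ(n)) ≥ (1/√7)·(√(9/7))ⁿ ≈ 0.37 × 1.13ⁿ`":
every `(S²_+)^r`-factorization of `UDISJ(n)` (`n ≥ 2`) has `(1/√7)(√(9/7))ⁿ ≤ r` (from
`3ⁿ ≤ r·7^{⌊(n−1)/2⌋+1}`). [cite: FawziParrilo2013, Thm. 4 and the display following it (§2.4, p. 9)] -/
theorem FawziParrilo2013_rank_S2_udisj {n r : ℕ} (hn : 2 ≤ n) (h : HasPsdPowerFactorization (udisj n) 2 r) :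
    1 / Real.sqrt 7 * Real.sqrt (9 / 7) ^ n ≤ (r : ℝ) := by
  have hmain := three_pow_le_of_hasUniformCovering (by norm_num) hn hasUniformCovering_atoms_two h
  have hmainR : (3 : ℝ) ^ n ≤ (r : ℝ) * 7 ^ ((n - 1) / 2 + 1) := by exact_mod_cast hmain
  have hs7 : 0 < Real.sqrt 7 := Real.sqrt_pos.2 (by norm_num)
  have hs7one : 1 ≤ Real.sqrt 7 := by
    rw [show (1 : ℝ) = Real.sqrt 1 from Real.sqrt_one.symm]
    exact Real.sqrt_le_sqrt (by norm_num)
  have hsq : Real.sqrt 7 ^ 2 = 7 := Real.sq_sqrt (by norm_num)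
  have h97 : Real.sqrt (9 / 7) = 3 / Real.sqrt 7 := by
    rw [Real.sqrt_div' 9 (by norm_num : (0 : ℝ) ≤ 7), show (9 : ℝ) = 3 ^ 2 by norm_num,
      Real.sqrt_sq (by norm_num : (0 : ℝ) ≤ 3)]
  -- `7^E = (√7)^{2E} ≤ (√7)^{n+1}`
  have hE : 2 * ((n - 1) / 2 + 1) ≤ n + 1 := by omega
  have h7E : (7 : ℝ) ^ ((n - 1) / 2 + 1) ≤ Real.sqrt 7 ^ (n + 1) := by
    conv_lhs => rw [← hsq, ← pow_mul]
    exact pow_le_pow_right₀ hs7one hE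
  rw [h97, div_pow, one_div, ← div_eq_inv_mul, div_div, ← pow_succ]
  -- goal: 3^n / (√7)^(n+1) ≤ r
  rw [div_le_iff₀ (by positivity)]
  calc (3 : ℝ) ^ n ≤ (r : ℝ) * 7 ^ ((n - 1) / 2 + 1) := hmainR
    _ ≤ (r : ℝ) * Real.sqrt 7 ^ (n + 1) := mul_le_mul_of_nonneg_left h7E (Nat.cast_nonneg _)


/-! ### F8. The slack matrix of `COR(n)` and its `UDISJ(n)` submatrix -/

/-- The full slack matrix of `COR(n)`: rows = valid inequalities `Σ_{ij} c_{ij} x_i x_j ≤ b` on `{0,1}ⁿ`,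
columns = the points `x ∈ {0,1}ⁿ` (the currency of `LeeRaghavendraSteurer2015_thm11` and
`FawziParrilo2013_thm1`, which inline this expression). [cite: FawziParrilo2013, §2.1 (p. 5, "COR(n) = conv{aaᵀ}")] -/
def corrSlack (n : ℕ) :
    {cb : Matrix (Fin n) (Fin n) ℝ × ℝ //
        ∀ x : Fin n → ℝ, (∀ i, x i = 0 ∨ x i = 1) → ∑ i, ∑ j, cb.1 i j * (x i * x j) ≤ cb.2} →
      {x : Fin n → ℝ // ∀ i, x i = 0 ∨ x i = 1} → ℝ :=
  fun cb x => cb.1.2 - ∑ i, ∑ j, cb.1.1 i j * (x.1 i * x.1 j)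

/-- **`UDISJ(n)` is a submatrix of the slack matrix of `COR(n)`** (rows: the valid inequalities
`(1 − aᵀx)² ≥ 0`, i.e. `2Σ_i a_i x_i − (Σ_i a_i x_i)² ≤ 1`, `a ∈ {0,1}ⁿ`; columns: `x = b ∈ {0,1}ⁿ`); hence an
`(S^d_+)^r`-factorization of the slack matrix restricts to one of `UDISJ(n)`.
[cite: FawziParrilo2013, §2.1 (pp. 5–6) and §1.2 (p. 5, "Strategy of proof")] -/
theorem hasPsdPowerFactorization_udisj_of_corrSlack {n d r : ℕ}
    (h : HasPsdPowerFactorization (corrSlack n) d r) : HasPsdPowerFactorization (udisj n) d r := by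
  classical
  let vec : Cube n → Fin n → ℝ := fun a i => if a i = true then 1 else 0
  have hvec : ∀ a i, vec a i = 0 ∨ vec a i = 1 := fun a i => by
    simp only [vec]; split_ifs <;> simp
  let Q : Cube n → Matrix (Fin n) (Fin n) ℝ := fun a i j =>
    (if i = j then 2 * vec a i else 0) - vec a i * vec a j
  have hQvalid : ∀ a (x : Fin n → ℝ), (∀ i, x i = 0 ∨ x i = 1) →
      ∑ i, ∑ j, Q a i j * (x i * x j) ≤ 1 := by
    intro a x hx
    change ∑ i, ∑ j, ((if i = j then 2 * vec a i else 0) - vec a i * vec a j) * (x i * x j) ≤ 1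
    rw [quadForm_eq _ _ hx]
    nlinarith [sq_nonneg (1 - ∑ i, vec a i * x i)]
  let row : Cube n → {cb : Matrix (Fin n) (Fin n) ℝ × ℝ //
      ∀ x : Fin n → ℝ, (∀ i, x i = 0 ∨ x i = 1) → ∑ i, ∑ j, cb.1 i j * (x i * x j) ≤ cb.2} :=
    fun a => ⟨(Q a, 1), hQvalid a⟩
  let col : Cube n → {x : Fin n → ℝ // ∀ i, x i = 0 ∨ x i = 1} := fun b => ⟨vec b, hvec b⟩
  have heq : (fun a b => corrSlack n (row a) (col b)) = udisj n := by
    funext a b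
    change 1 - ∑ i, ∑ j, ((if i = j then 2 * vec a i else 0) - vec a i * vec a j) * (vec b i * vec b j)
      = (1 - (ip a b : ℝ)) ^ 2
    rw [quadForm_eq _ _ (hvec b), ip_cast]
    ring
  exact heq ▸ h.submatrix row col

end FixedSizePsdRank

open FixedSizePsdRank in
/-- **Fawzi–Parrilo 2013, Theorem 1** (arXiv:1311.2571, §1.2 p. 4, verbatim): "Let `d ≥ 1` be a fixed
integer. For `n ≥ d`, if `COR(n)` has a `(S^d_+)^r`-lift for some `r ∈ ℕ`, then necessarily
`r ≥ κ(d)·c(d)ⁿ` where `c(d) = (1 − 1/3^d)^{−1/d} > 1` and `κ(d) = (3^d − 1)^{−(1−1/d)}`."  Dictionary: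
`COR(n) = conv{aaᵀ : a ∈ {0,1}ⁿ}` (§2.1, p. 5); "`P` has a `K`-lift where `K = S^d_+ × ⋯ × S^d_+` if
`P = π(K ∩ L)`" (§1, p. 2); by the cone-factorization theorem (Thm. 2, p. 6 = Gouveia–Parrilo–Thomas) a
`(S^d_+)^r`-lift is a factorization of the slack matrix of `COR(n)` through `(S^d_+)^r`, "a decomposition
of the slack matrix as a sum of `r` nonnegative matrices each of psd rank `≤ d`" (§1.2, p. 5,
"Strategy of proof").  Stated — as the tree's `LeeRaghavendraSteurer2015_thm11` — for the FULL slack matrix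
of `COR(n)` (rows = all valid inequalities `Σ_{ij} c_{ij} x_i x_j ≤ b` on `{0,1}ⁿ`, columns = all
`x ∈ {0,1}ⁿ`), which contains every slack matrix of `COR(n)` as a submatrix: an `(S^d_+)^r`-factorization
(`HasPsdPowerFactorization`) of it forces `κ(d)·c(d)ⁿ ≤ r`.
[cite: FawziParrilo2013, Theorem 1 (§1.2, p. 4)] -/
def FawziParrilo2013_thm1 : Prop :=
  ∀ d : ℕ, 1 ≤ d → ∀ n : ℕ, d ≤ n → ∀ r : ℕ,
    HasPsdPowerFactorization
      (fun (cb : {cb : Matrix (Fin n) (Fin n) ℝ × ℝ //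
              ∀ x : Fin n → ℝ, (∀ i, x i = 0 ∨ x i = 1) →
                ∑ i, ∑ j, cb.1 i j * (x i * x j) ≤ cb.2})
           (x : {x : Fin n → ℝ // ∀ i, x i = 0 ∨ x i = 1}) =>
        cb.1.2 - ∑ i, ∑ j, cb.1.1 i j * (x.1 i * x.1 j)) d r →
    ((3 : ℝ) ^ d - 1) ^ (-(1 - 1 / (d : ℝ))) * ((1 - 1 / (3 : ℝ) ^ d) ^ (-(1 / (d : ℝ)))) ^ n ≤ (r : ℝ)

open FixedSizePsdRank in
/-- Proof of `FawziParrilo2013_thm1`, following the printed argument: the rows `(1 − aᵀx)² ≥ 0`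
(`a ∈ {0,1}ⁿ`) of the slack matrix form `UDISJ(n)` (§2.1), so an `(S^d_+)^r`-factorization gives
`3ⁿ ≤ r·(3^d−1)^{⌊(n−1)/d⌋+1}` (eq. (9)), and `3ⁿ/(3^d−1)^{⌊(n−1)/d⌋+1} ≥ (3^d−1)^{−(1−1/d)}·((1−3^{−d})^{−1/d})ⁿ`.
[cite: FawziParrilo2013, Theorem 1 (§1.2, p. 4; proof §2.5 "Putting things together", p. 11)] -/
theorem FawziParrilo2013_thm1_holds : FawziParrilo2013_thm1 := by
  classical
  intro d hd n hnd r hfac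
  -- Step 1 (§2.1): `UDISJ(n)` is a submatrix of the slack matrix
  have hud : HasPsdPowerFactorization (udisj n) d r := hasPsdPowerFactorization_udisj_of_corrSlack hfac
  -- Step 2 (eq. (9)): `3ⁿ ≤ r (3^d - 1)^{⌊(n-1)/d⌋+1}`
  have hmain := three_pow_le_of_hasPsdPowerFactorization_udisj hd hnd hud
  -- Step 3: real arithmetic `3ⁿ/(3^d−1)^{⌊(n−1)/d⌋+1} ≥ κ(d) c(d)ⁿ`
  set q : ℝ := (3 : ℝ) ^ d - 1 with hq
  have h3d : (0 : ℝ) < 3 ^ d := by positivity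
  have hq1 : 1 ≤ q := by
    have : (3 : ℝ) ≤ 3 ^ d := by
      calc (3 : ℝ) = 3 ^ 1 := (pow_one _).symm
        _ ≤ 3 ^ d := pow_le_pow_right₀ (by norm_num) hd
    rw [hq]; linarith
  have hq0 : 0 < q := by linarith
  have hd0 : (d : ℝ) ≠ 0 := Nat.cast_ne_zero.2 (by omega)
  have hmainR : (3 : ℝ) ^ n ≤ (r : ℝ) * q ^ ((n - 1) / d + 1) := by
    have h1 : ((3 ^ d - 1 : ℕ) : ℝ) = q := by
      rw [Nat.cast_sub (Nat.one_le_pow _ _ (by norm_num))]; simp [hq]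
    have h2 : ((3 ^ n : ℕ) : ℝ) ≤ ((r * (3 ^ d - 1) ^ ((n - 1) / d + 1) : ℕ) : ℝ) := by
      exact_mod_cast hmain
    rw [Nat.cast_mul, Nat.cast_pow (3 ^ d - 1), h1] at h2
    simpa using h2
  simp only [one_div]
  -- `c(d) = 3 · q^{-1/d}`
  have hc : (1 - ((3 : ℝ) ^ d)⁻¹) ^ (-(d : ℝ)⁻¹) = 3 * q ^ (-(d : ℝ)⁻¹) := by
    have hbase : 1 - ((3 : ℝ) ^ d)⁻¹ = q / 3 ^ d := by
      rw [hq]; field_simp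
    rw [hbase, Real.div_rpow hq0.le h3d.le, Real.rpow_neg h3d.le,
      Real.pow_rpow_inv_natCast (by norm_num : (0 : ℝ) ≤ 3) (by omega : d ≠ 0), div_inv_eq_mul,
      mul_comm]
  rw [hc, mul_pow, ← Real.rpow_natCast (q ^ (-(d : ℝ)⁻¹)) n, ← Real.rpow_mul hq0.le]
  have hexp : -(1 - (d : ℝ)⁻¹) + -(d : ℝ)⁻¹ * (n : ℝ) = -(1 + ((n : ℝ) - 1) / d) := by
    field_simp
    ring
  have hprod : q ^ (-(1 - (d : ℝ)⁻¹)) * ((3 : ℝ) ^ n * q ^ (-(d : ℝ)⁻¹ * (n : ℝ)))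
      = 3 ^ n * q ^ (-(1 + ((n : ℝ) - 1) / d)) := by
    rw [mul_left_comm, ← Real.rpow_add hq0, hexp]
  rw [hprod]
  have hE : (((n - 1) / d + 1 : ℕ) : ℝ) ≤ 1 + ((n : ℝ) - 1) / d := by
    have h := Nat.cast_div_le (m := n - 1) (n := d) (α := ℝ)
    rw [Nat.cast_sub (by omega : 1 ≤ n)] at h
    push_cast
    linarith
  have hqpow : q ^ (-(1 + ((n : ℝ) - 1) / d)) ≤ (q ^ ((n - 1) / d + 1))⁻¹ := by
    rw [← Real.rpow_natCast q ((n - 1) / d + 1), ← Real.rpow_neg hq0.le]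
    exact Real.rpow_le_rpow_of_exponent_le hq1 (by linarith)
  calc (3 : ℝ) ^ n * q ^ (-(1 + ((n : ℝ) - 1) / d)) ≤ 3 ^ n * (q ^ ((n - 1) / d + 1))⁻¹ :=
        mul_le_mul_of_nonneg_left hqpow (by positivity)
    _ ≤ r := by
        rw [← div_eq_mul_inv, div_le_iff₀ (by positivity)]
        exact hmainR


open FixedSizePsdRank in
/-- **Fawzi–Parrilo 2013, Theorem 1 for `d = 2` with the sharper constants** (p. 4, verbatim: "For the special
case `d = 2`, the constants `κ(2)` and `c(2)` can be taken to be: `κ(2) = 1/√7`, `c(2) = √(9/7) ≈ 1.13`"): an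
`(S²_+)^r`-factorization (second-order-cone lift currency) of the slack matrix of `COR(n)`, `n ≥ 2`, has
`(1/√7)·(√(9/7))ⁿ ≤ r`. [cite: FawziParrilo2013, Thm. 1, case d = 2 (§1.2, p. 4; §2.4, pp. 9–10)] -/
theorem FawziParrilo2013_thm1_two {n r : ℕ} (hn : 2 ≤ n) (h : HasPsdPowerFactorization (corrSlack n) 2 r) :
    1 / Real.sqrt 7 * Real.sqrt (9 / 7) ^ n ≤ (r : ℝ) :=
  FawziParrilo2013_rank_S2_udisj hn (hasPsdPowerFactorization_udisj_of_corrSlack h)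

open FixedSizePsdRank in
/-- **FP13 Theorem 1 at `d = 1` = the LP bound of Fiorini et al. / Kaibel–Weltge** ("Theorem 1 generalizes the
existing lower bounds on LP extended formulations of the correlation polytope … captured by the case `d = 1`",
p. 4; `c(1) = 3/2`, `κ(1) = 1`): a nonnegative (= `(S^1_+)^r`) factorization of the slack matrix of `COR(n)`
(`n ≥ 1`) has size `r ≥ (3/2)ⁿ`. [cite: FawziParrilo2013, Thm. 1, case d = 1 (§1.2, p. 4) and §2.2 (p. 7, "val(M) ≤ 2ⁿ … Kaibel–Weltge")] -/
theorem FawziParrilo2013_thm1_one {n r : ℕ} (hn : 1 ≤ n) (h : HasPsdPowerFactorization (corrSlack n) 1 r) :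
    (3 / 2 : ℝ) ^ n ≤ (r : ℝ) := by
  have hmain := three_pow_le_of_hasPsdPowerFactorization_udisj le_rfl hn
    (hasPsdPowerFactorization_udisj_of_corrSlack h)
  have hexp : (n - 1) / 1 + 1 = n := by omega
  rw [hexp] at hmain
  have h2 : (3 : ℝ) ^ n ≤ (r : ℝ) * 2 ^ n := by exact_mod_cast hmain
  rw [div_pow, div_le_iff₀ (by positivity)]
  exact h2

open FixedSizePsdRank in
/-- **Psd-rank bounds bound block lifts** (FP13 §1.1: "lower bounds on the size of `(S^d_+)^r` lifts can be
obtained from lower bounds on PSD-lifts"): conditional on the named fact `LeeRaghavendraSteurer2015_thm11`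
(`rk_psd(COR_n) ≥ 2^{α n^{2/13}}`), every `(S^d_+)^r`-factorization of the slack matrix of `COR(n)` has
`d·r ≥ 2^{α n^{2/13}}` — via `(S^d_+)^r ⊆ S^{dr}_+` (`HasPsdPowerFactorization.hasPsdFactorization`). (FP13,
written before LRS, notes that the then-available psd-rank bounds "will not allow to show … that `COR(n)` does not
admit a polynomial-size SOCP representation"; Theorem 1 is unconditional.)
[cite: FawziParrilo2013, §1.1 (p. 3)] [cite: LeeRaghavendraSteurer2015, Theorem 1.1] -/
theorem corrSlack_blocks_of_leeRaghavendraSteurer (hLRS : LeeRaghavendraSteurer2015_thm11) :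
    ∃ α : ℝ, 0 < α ∧ ∀ n : ℕ, 1 ≤ n → ∀ d r : ℕ, HasPsdPowerFactorization (corrSlack n) d r →
      (2 : ℝ) ^ (α * (n : ℝ) ^ ((2 : ℝ) / 13)) ≤ ((d * r : ℕ) : ℝ) := by
  obtain ⟨α, hα, H⟩ := hLRS
  refine ⟨α, hα, fun n hn d r h => ?_⟩
  by_contra hlt
  push Not at hlt
  obtain ⟨U, V, hU, hV, hUV⟩ := h.hasPsdFactorization
  exact H n hn (d * r) hlt ⟨U, V, hU, hV, fun cb x => hUV cb x⟩

end Literature.Combinatorics.Optimization
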